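import Literature.MathematicalPhysics.QuantumFieldTheory.Balaban1983to89.T4CouplingIncoherence

/-!
# T4DobrushinTensorisation — Dobrushin's row-sum condition ⇒ the tensorised Efron–Stein inequality

(kernel-proved, `[folklore]`; finite `T⁴` bookkeeping for the NE1′ (O3b/H2) coupling line,
rung (B)+1 of the Bałaban 1983–89 audit; NOT infinite volume, NOT a mass gap, NOT Clay.)

## What this leaf does

`T4CouplingIncoherence` §9 reduced the per-step innovation variance of the pathwise
(dressed − undressed) coupling to ONE hypothesis shape, the *tensorised Efron–Stein
inequality* `hES` for the law `Q` of the innovation field `ξ = (ξᵢ)_{i : ι}` with respect to a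
family of single-site resampling kernels `qᵢ ξ` (a regular conditional law of `ξᵢ` given
`ξ_{≠ i}`):

  `Var_Q G ≤ C_T · ½ ∑ᵢ ∫ ∫ (G ξ − G (update ξ i y))² d(qᵢ ξ)(y) dQ(ξ)`       (hES)

with `C_T = 1` for a product law (`efronStein_pi_const`).  For the dressed, non-product
innovation laws the constant `C_T` is the currency of the estimate, and the record
`T4-EST-NE1p-P2.md` v1.18 left the implication «weak dependence ⇒ (hES) with a
`μ`-uniform `C_T`» as a located-but-unformalised analysis input.

This file PROVES, in the kernel and with no cited hypothesis, the classical implication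

  Dobrushin row sums `∑_{j ≠ i} C i j ≤ α < 1`  ⟹  (hES) with `C_T = 1 / (1 − α)`,

for single-site kernels that are *local* (`qᵢ (update ξ i y) = qᵢ ξ`: the kernel at site `i`
does not read the coordinate it resamples) and *resampling-invariant* for `Q`
(`∫ (∫ F (update ξ i y) d(qᵢ ξ)(y)) dQ = ∫ F dQ`, i.e. `qᵢ` is a version of the conditional law
of the `i`-th coordinate), where `C i j` bounds, in the dual (oscillation) form of total
variation, the dependence of `qᵢ ξ` on the coordinate `ξⱼ`:

  `|∫ g d(qᵢ (update ξ j y)) − ∫ g d(qᵢ (update ξ j y'))| ≤ C i j · osc g`.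

Main theorem: `efronSteinWith_of_dobrushin`.  Its conclusion is *literally* the binder `hES`
of `T4CouplingIncoherence.oneStepVar_le_of_rep_efronSteinWith` with `CT := 1 / (1 - α)`, and
§6 composes it with the end-to-end bounds of `T4CouplingIncoherence` §9(b)
(`integral_sq_sub_towerMean_le_of_graded_geometric_dobrushin(_pathLaw)`): after this leaf the
analysis input of the NE1′ coupling line on the tensorisation side is a UNIFORM DOBRUSHIN
ROW-SUM BOUND `α₀ < 1` for the single-innovation conditional kernels of the dressed innovation
laws — the shape in which cluster / decoupling expansions deliver weak dependence — and no
longer an abstract Poincaré constant.  `dobrushinBound_of_minorised` (§3) shows how a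
two-sided MINORISATION `m i j • qᵢ(… y …) ≤ qᵢ(… y' …)` of the resampling laws (e.g. from a
two-sided bound on the ratio of single-site conditional densities) yields the interdependence
bound with `C i j = 1 − m i j`.  §7 (v2) instantiates ALL the hypotheses for the one-site
GIBBS KERNELS of a bounded measurable energy `A` on a finite product `(Π i, E i, ⊗ᵢ πᵢ)`:
the kernels `qᵢ(ξ)(dy) ∝ exp (−A (update ξ i y)) πᵢ(dy)` are Markov, local and
resampling-invariant for the Gibbs law `Q ∝ exp (−A) ⊗ᵢπᵢ` (the DLR identity on a finite
product, PROVED via an exchange identity for `⊗ᵢ πᵢ`), and a bound `δ i j` on the MIXED SECOND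
DIFFERENCES of `A` in the coordinates `i ≠ j` gives the minorisation `m i j = exp (−δ i j)`;
so `efronSteinWith_of_gibbs(_linear)` delivers (hES) for `Q` with `C_T = 1/(1−α)` from the
SUP-NORM condition `∑_{j≠i} δ i j ≤ α < 1` on the energy alone (Dobrushin's classical
high-temperature criterion in its interaction form).  After §7 the tensorisation-side
analysis input of the NE1′ line reads: a level/history/volume-uniform bound on the mixed
second differences between distinct innovation sites of the effective one-step action on its
small-field region — LOCATED in the record, not proved here.

Sections: §0 scalar helpers (bounded ⇒ integrable, Cauchy–Schwarz, the log-convexity upgrade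
`ratio_le_of_logConvex_of_le_geometric`) · §1 site-wise oscillation vectors (`OscBound`, hybrid
bound, centred sup bound) · §2 the operators `resample` (`Πᵢ`) and `heatBath` (`T`) · §3
Dobrushin's contraction (`DobrushinBound`, `rowVec`, `dobVec`, `sum_dobVec_le`,
`iterate_heatBath_osc`) · §4 resampling invariance (`ResamplingInvariant`): mean preservation,
`Q`-symmetry of `T`, the Dirichlet-form identities · §5 the Poincaré inequality
`integral_mul_heatBath_le` and the main theorem · §6 composition with the tower bound · §7
one-site Gibbs kernels (`gibbsKernel`, `gibbsMeasure`, `integral_integral_update_swap`,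
`resamplingInvariant_gibbs`, `gibbsKernel_minorised`, `efronSteinWith_of_gibbs`).

v2 (this revision) also retires the v1 §0 wrapper `integrable_of_abs_le` in favour of the
in-scope `T4CouplingChain.integrable_of_abs_le_const` (review advisory on v1); the
measurability-free `abs_integral_le_of_abs_le` is kept on purpose — it feeds the
measurability-free sup bounds `abs_resample_le` / `abs_heatBath_le` / `abs_iterate_heatBath_le`,
whose statements would otherwise acquire measurability binders.

## Proof route (elementary; no spectral theorem)

Let `N = card ι`, `Πᵢ f ξ = ∫ f (update ξ i y) d(qᵢ ξ)(y)` and `T = N⁻¹ ∑ᵢ Πᵢ` (the random-scan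
heat-bath operator).  (1) Oscillation vectors: if `|f (update ξ j y) − f (update ξ j y')| ≤ d j`
for all `j, ξ, y, y'` then the same holds for `T f` with the vector
`(M d) j = N⁻¹ ∑_{i ≠ j} (d j + C i j · d i)`, and `∑ⱼ (M d) j ≤ ρ ∑ⱼ d j` with
`ρ = 1 − (1 − α)/N` (locality kills the `i = j` term; the `C i j` term is the Dobrushin
hypothesis).  (2) A `Q`-centred `f` is bounded pointwise by `∑ⱼ d j` (hybrid/telescoping over
the sites).  (3) `T` is `Q`-symmetric and mean-preserving (locality + resampling invariance),
so `bₘ = ∫ (T^m f)² dQ` is log-convex (Cauchy–Schwarz) and `bₘ = ∫ f · T^{2m} f dQ ≤ K ρ^{2m}`;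
log-convexity upgrades the asymptotic rate to the one-step bound `b₁ ≤ ρ² b₀`, whence
`∫ f · T f dQ ≤ ρ ∫ f² dQ`, i.e. the Poincaré inequality `Var_Q f ≤ (N/(1−α)) ⟨f, (I − T) f⟩_Q`,
and `N ⟨f, (I − T) f⟩_Q = ½ ∑ᵢ ∫∫ (f ξ − f (update ξ i y))² dqᵢ dQ` is (hES).

## Relation to the tree's Dobrushin modules (no duplication, no conflict)

* `OscBound` is the `Function.update`-form twin (dependent coordinate types `E i`, no built-in
  non-negativity) of `Literature.Probability.LatticeModels.Dobrushin.IsOscBound`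
  (Friedli–Velenik (6.38)); `oscBound_resample` PROVES — for local Markov kernels under
  `DobrushinBound` — the total-variation "dusting estimate" (Friedli–Velenik Lemma 6.34) that the
  abstract comparison framework `Dobrushin.DustingData` of `DobrushinComparison.lean` takes as its
  INPUT field `dust`.
* The tree's Dobrushin files prove UNIQUENESS / COMPARISON of two invariant states (Dobrushin
  1968, Georgii Thm. 8.7 / 8.20, Föllmer's Vasserstein form) and run the strong-coupling
  lattice-gauge route `LatticeGaugeDobrushin*` (one-link Poincaré ⇒ Dobrushin's condition ⇒
  Shen–Zhu–Zhu).  The present leaf proves a different consequence of the same condition, absent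
  from the tree: a GLOBAL VARIANCE inequality (Poincaré / approximate tensorisation) for the
  law `Q` itself.
* `Balaban1983to89.MassGapDobrushinNoGo` proves that ONE-LINK Dobrushin uniqueness FAILS for the
  Wilson specification in the link variables at large `β`.  No conflict: here the condition is
  asked of the INNOVATION (fluctuation-field) law of ONE renormalisation step at fixed scale,
  conditionally on the block history — the small-field measures of the (2.18)-type effective
  actions, whose weak dependence is what B12 §3 / B13-type cluster expansions are designed to
  deliver — not of the full gauge specification; and whether a uniform `α₀ < 1` holds there is
  exactly the LOCATED, UNPROVED analysis input of the record, not a claim of this file.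

## Honest flags

* `[folklore]` throughout: every declaration is proved here from Mathlib; NO `def X : Prop`
  named fact, no cite tag, nothing taken as a hypothesis from print (the three `def … : Prop`
  of this file — `OscBound`, `DobrushinBound`, `ResamplingInvariant` — are NAMES FOR HYPOTHESIS
  SHAPES, unfolded verbatim in the statement of the main theorem, not asserted facts).
  Attribution of the STATEMENT type only (not used as input): the row-sum condition is
  Dobrushin's uniqueness condition (Dobrushin 1968/1970; Dobrushin–Shlosman 1985,
  doi:10.1007/978-1-4899-6653-7_20); Poincaré / spectral-gap inequalities for Gibbs measures
  and their Glauber-type dynamics in the Dobrushin uniqueness regime, with constants governed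
  by `1 − α`, are classical (L. Wu, Ann. Probab. 34 (2006) 1960–1989,
  doi:10.1214/009117906000000368).  The elementary log-convexity route above is chosen so that
  no spectral theorem and no finite-state-space assumption is needed; it is written out in
  full here and nothing of it is quoted.
* Nothing here touches `BetaPertH` / (B) / (B^μ): this is measure-theoretic bookkeeping on a
  finite index set; the analysis input it isolates (a uniform row-sum bound `α₀ < 1` for the
  dressed innovation laws of B12 (0.21) / B14 (2.18)-type actions) is LOCATED, not proved,
  exactly as recorded in `T4-EST-NE1p-P2.md`.
* Finite `T⁴`, finitely many sites (`[Fintype ι]`); bounded measurable observables only; in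
  §7 a BOUNDED energy (`|A| ≤ a`) and probability reference laws `πᵢ` — the small-field
  format; no claim is made about unbounded (large-field) actions.
-/

noncomputable section

open MeasureTheory ProbabilityTheory Finset Function
open scoped ENNReal

namespace Literature.MathematicalPhysics.QuantumFieldTheory.Balaban1983to89.T4DobrushinTensorisation

open Literature.MathematicalPhysics.QuantumFieldTheory.Balaban1983to89.T4CouplingChain
  (integrable_of_abs_le_const)

universe u v

variable {ι : Type u} [Fintype ι] [DecidableEq ι] {E : ι → Type v} [∀ i, MeasurableSpace (E i)]

/-! ## §0 Scalar helpers -/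

section Scalar

/-- `[folklore]` `|∫ g dμ| ≤ B` for a probability measure and `|g| ≤ B` — WITHOUT any
measurability hypothesis on `g` (for a non-integrable `g` the integral is `0 ≤ B`).  Kept next to
`T4CouplingChain.abs_integral_le_of_abs_le_const` (which asks `AEStronglyMeasurable g`) on
purpose: it is what makes the sup bounds `abs_resample_le`, `abs_heatBath_le`,
`abs_iterate_heatBath_le` measurability-free. -/
theorem abs_integral_le_of_abs_le {X : Type*} [MeasurableSpace X] (μ : Measure X)
    [IsProbabilityMeasure μ] {g : X → ℝ} {B : ℝ} (hB : ∀ x, |g x| ≤ B) :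
    |∫ x, g x ∂μ| ≤ B := by
  have h := norm_integral_le_of_norm_le_const (μ := μ) (f := g) (C := B)
    (Filter.Eventually.of_forall fun x => by rw [Real.norm_eq_abs]; exact hB x)
  rwa [Real.norm_eq_abs, probReal_univ, mul_one] at h

/-- `[folklore]` Cauchy–Schwarz for bounded measurable real functions and a finite measure,
proved from the non-negativity of `∫ (u − t v)²` (discriminant argument). -/
theorem sq_integral_mul_le {X : Type*} [MeasurableSpace X] (μ : Measure X) [IsFiniteMeasure μ]
    {u v : X → ℝ} (hu : Measurable u) (hv : Measurable v) {Bu Bv : ℝ}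
    (hBu : ∀ x, |u x| ≤ Bu) (hBv : ∀ x, |v x| ≤ Bv) :
    (∫ x, u x * v x ∂μ) ^ 2 ≤ (∫ x, u x ^ 2 ∂μ) * (∫ x, v x ^ 2 ∂μ) := by
  have hBu0 : ∀ x, 0 ≤ Bu := fun x => (abs_nonneg _).trans (hBu x)
  have hBv0 : ∀ x, 0 ≤ Bv := fun x => (abs_nonneg _).trans (hBv x)
  have hiuv : Integrable (fun x => u x * v x) μ :=
    integrable_of_abs_le_const (μ := μ) (hu.mul hv).stronglyMeasurable (R := Bu * Bv) fun x => by
      rw [abs_mul]; exact mul_le_mul (hBu x) (hBv x) (abs_nonneg _) (hBu0 x)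
  have hiuu : Integrable (fun x => u x ^ 2) μ :=
    integrable_of_abs_le_const (μ := μ) (hu.pow_const 2).stronglyMeasurable (R := Bu ^ 2) fun x => by
      rw [abs_pow]; exact pow_le_pow_left₀ (abs_nonneg _) (hBu x) 2
  have hivv : Integrable (fun x => v x ^ 2) μ :=
    integrable_of_abs_le_const (μ := μ) (hv.pow_const 2).stronglyMeasurable (R := Bv ^ 2) fun x => by
      rw [abs_pow]; exact pow_le_pow_left₀ (abs_nonneg _) (hBv x) 2
  set A := ∫ x, u x ^ 2 ∂μ with hA
  set P := ∫ x, u x * v x ∂μ with hP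
  set Bq := ∫ x, v x ^ 2 ∂μ with hBq
  have hquad : ∀ t : ℝ, 0 ≤ A - 2 * t * P + t ^ 2 * Bq := by
    intro t
    have h0 : 0 ≤ ∫ x, (u x - t * v x) ^ 2 ∂μ := integral_nonneg fun x => sq_nonneg _
    have hexp : ∫ x, (u x - t * v x) ^ 2 ∂μ = A - 2 * t * P + t ^ 2 * Bq := by
      have h1 : ∀ x, (u x - t * v x) ^ 2
          = (u x ^ 2 - (2 * t) * (u x * v x)) + t ^ 2 * v x ^ 2 := fun x => by ring
      simp_rw [h1]
      have hi3 : Integrable (fun x => u x ^ 2 - (2 * t) * (u x * v x)) μ :=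
        hiuu.sub (hiuv.const_mul _)
      rw [integral_add hi3 (hivv.const_mul _), integral_sub hiuu (hiuv.const_mul _),
        integral_const_mul, integral_const_mul]
    rw [hexp] at h0
    exact h0
  have hBq0 : 0 ≤ Bq := integral_nonneg fun x => sq_nonneg _
  rcases hBq0.eq_or_lt with hBq00 | hBqpos
  · -- `∫ v² = 0` forces `∫ u v = 0`
    have hP0 : P = 0 := by
      by_contra hPne
      have h1 := hquad ((A + 1) / (2 * P))
      rw [← hBq00, mul_zero, add_zero] at h1
      have h2 : A - 2 * ((A + 1) / (2 * P)) * P = -1 := by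
        field_simp
        ring
      rw [h2] at h1
      norm_num at h1
    rw [hP0, ← hBq00]
    simp
  · have h1 := hquad (P / Bq)
    have h2 : A - 2 * (P / Bq) * P + (P / Bq) ^ 2 * Bq = A - P ^ 2 / Bq := by
      field_simp
      ring
    rw [h2] at h1
    have h3 : P ^ 2 / Bq ≤ A := by linarith
    rw [div_le_iff₀ hBqpos] at h3
    exact h3

/-- `[folklore]` The log-convexity upgrade: a non-negative log-convex sequence dominated by a
geometric sequence of ratio `s` has first ratio at most `s`. -/
theorem ratio_le_of_logConvex_of_le_geometric {b : ℕ → ℝ} {K s : ℝ} (hb0 : ∀ n, 0 ≤ b n)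
    (hlc : ∀ n, b (n + 1) ^ 2 ≤ b n * b (n + 2)) (hs : 0 ≤ s) (hK : ∀ n, b n ≤ K * s ^ n) :
    b 1 ≤ s * b 0 := by
  rcases le_or_gt (b 1) (s * b 0) with h | h
  · exact h
  exfalso
  have hb1 : 0 < b 1 := lt_of_le_of_lt (mul_nonneg hs (hb0 0)) h
  have hb0pos : 0 < b 0 := by
    rcases (hb0 0).eq_or_lt with h0 | h0
    · exfalso
      have h1 := hlc 0
      rw [← h0, zero_mul] at h1
      nlinarith
    · exact h0
  set r := b 1 / b 0 with hr
  have hrs : s < r := by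
    rw [hr, lt_div_iff₀ hb0pos]
    linarith
  have hrpos : 0 < r := lt_of_le_of_lt hs hrs
  have key : ∀ n, 0 < b n ∧ r * b n ≤ b (n + 1) := by
    intro n
    induction n with
    | zero => exact ⟨hb0pos, by rw [hr, div_mul_cancel₀ _ hb0pos.ne']⟩
    | succ n ih =>
      obtain ⟨hpos, hstep⟩ := ih
      have hpos' : 0 < b (n + 1) := lt_of_lt_of_le (mul_pos hrpos hpos) hstep
      refine ⟨hpos', ?_⟩
      have h1 := hlc n
      have h2 : b n * (r * b (n + 1)) ≤ b n * b (n + 2) := by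
        have h3 : r * b n * b (n + 1) ≤ b (n + 1) * b (n + 1) :=
          mul_le_mul_of_nonneg_right hstep hpos'.le
        nlinarith
      exact le_of_mul_le_mul_left h2 hpos
  have geo : ∀ n, r ^ n * b 0 ≤ b n := by
    intro n
    induction n with
    | zero => simp
    | succ n ih =>
      calc r ^ (n + 1) * b 0 = r * (r ^ n * b 0) := by ring
        _ ≤ r * b n := mul_le_mul_of_nonneg_left ih hrpos.le
        _ ≤ b (n + 1) := (key n).2
  rcases hs.eq_or_lt with hs0 | hspos
  · have h1 := hK 1
    rw [← hs0] at h1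
    simp at h1
    linarith
  · have hgt : 1 < r / s := (one_lt_div hspos).mpr hrs
    obtain ⟨n, hn⟩ := pow_unbounded_of_one_lt (K / b 0) hgt
    have h1 : (r / s) ^ n ≤ K / b 0 := by
      rw [div_pow, div_le_div_iff₀ (pow_pos hspos n) hb0pos]
      calc r ^ n * b 0 ≤ b n := geo n
        _ ≤ K * s ^ n := hK n
    linarith

end Scalar

/-! ## §1 Single-site oscillation vectors -/

section Osc

/-- `[folklore]` `OscBound f d`: replacing the site-`j` coordinate of the argument moves `f` by
at most `d j` (a site-wise oscillation vector for `f`; Friedli–Velenik (6.38) in `update` form). -/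
def OscBound (f : ((j : ι) → E j) → ℝ) (d : ι → ℝ) : Prop :=
  ∀ (j : ι) (ξ : (k : ι) → E k) (y y' : E j), |f (update ξ j y) - f (update ξ j y')| ≤ d j

omit [Fintype ι] [∀ i, MeasurableSpace (E i)] in
/-- `[folklore]` A function bounded by `B` has oscillation vector `2B`. -/
theorem oscBound_of_abs_le {f : ((j : ι) → E j) → ℝ} {B : ℝ} (hB : ∀ ξ, |f ξ| ≤ B) :
    OscBound f (fun _ => 2 * B) := by
  intro j ξ y y'
  have h1 := hB (update ξ j y)
  have h2 := hB (update ξ j y')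
  calc |f (update ξ j y) - f (update ξ j y')|
      ≤ |f (update ξ j y)| + |f (update ξ j y')| := abs_sub _ _
    _ ≤ 2 * B := by linarith

omit [Fintype ι] [∀ i, MeasurableSpace (E i)] in
/-- `[folklore]` Hybrid (telescoping) bound: changing the coordinates in `s` moves `f` by at
most `∑_{j ∈ s} d j`. -/
theorem OscBound.abs_sub_piecewise_le {f : ((j : ι) → E j) → ℝ} {d : ι → ℝ}
    (hf : OscBound f d) (ξ ξ' : (k : ι) → E k) (s : Finset ι) :
    |f (s.piecewise ξ' ξ) - f ξ| ≤ ∑ j ∈ s, d j := by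
  induction s using Finset.induction_on with
  | empty => simp
  | @insert j s hj ih =>
    rw [Finset.piecewise_insert, Finset.sum_insert hj]
    have h1 : |f (update (s.piecewise ξ' ξ) j (ξ' j)) - f (s.piecewise ξ' ξ)| ≤ d j := by
      have h2 := hf j (s.piecewise ξ' ξ) (ξ' j) ((s.piecewise ξ' ξ) j)
      rwa [update_eq_self] at h2
    calc |f (update (s.piecewise ξ' ξ) j (ξ' j)) - f ξ|
        ≤ |f (update (s.piecewise ξ' ξ) j (ξ' j)) - f (s.piecewise ξ' ξ)|
            + |f (s.piecewise ξ' ξ) - f ξ| := abs_sub_le _ _ _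
      _ ≤ d j + ∑ k ∈ s, d k := add_le_add h1 ih

omit [∀ i, MeasurableSpace (E i)] in
/-- `[folklore]` Total oscillation bound `|f ξ' − f ξ| ≤ ∑ⱼ d j`. -/
theorem OscBound.abs_sub_le_sum {f : ((j : ι) → E j) → ℝ} {d : ι → ℝ}
    (hf : OscBound f d) (ξ ξ' : (k : ι) → E k) : |f ξ' - f ξ| ≤ ∑ j, d j := by
  have h := hf.abs_sub_piecewise_le ξ ξ' Finset.univ
  rwa [Finset.piecewise_univ] at h

/-- `[folklore]` A `Q`-centred function is bounded pointwise by its total oscillation. -/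
theorem OscBound.abs_le_sum_of_integral_eq_zero {f : ((j : ι) → E j) → ℝ} {d : ι → ℝ}
    (hf : OscBound f d) (Q : Measure ((k : ι) → E k)) [IsProbabilityMeasure Q]
    (hfi : Integrable f Q) (h0 : ∫ ξ, f ξ ∂Q = 0) (ξ : (k : ι) → E k) :
    |f ξ| ≤ ∑ j, d j := by
  have h1 : f ξ = ∫ ξ', (f ξ - f ξ') ∂Q := by
    rw [integral_sub (integrable_const _) hfi, h0, sub_zero, integral_const, smul_eq_mul,
      probReal_univ, one_mul]
  rw [h1]
  exact abs_integral_le_of_abs_le Q fun ξ' => by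
    rw [abs_sub_comm]; exact hf.abs_sub_le_sum ξ ξ'

end Osc

/-! ## §2 The single-site resampling operators and the heat-bath average -/

section Resample

variable (q : (i : ι) → Kernel ((j : ι) → E j) (E i))

/-- `[folklore]` The single-site resampling operator `Πᵢ f ξ = ∫ f (update ξ i y) d(qᵢ ξ)(y)`. -/
def resample (i : ι) (f : ((j : ι) → E j) → ℝ) : ((j : ι) → E j) → ℝ :=
  fun ξ => ∫ y, f (update ξ i y) ∂(q i ξ)

/-- `[folklore]` The random-scan heat-bath (Glauber) average `T f = (card ι)⁻¹ ∑ᵢ Πᵢ f`. -/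
def heatBath (f : ((j : ι) → E j) → ℝ) : ((j : ι) → E j) → ℝ :=
  fun ξ => (Fintype.card ι : ℝ)⁻¹ * ∑ i, resample q i f ξ

variable {q}

omit [Fintype ι] in
/-- `[folklore]` Unfolding `resample`. -/
theorem resample_apply (i : ι) (f : ((j : ι) → E j) → ℝ) (ξ : (j : ι) → E j) :
    resample q i f ξ = ∫ y, f (update ξ i y) ∂(q i ξ) := rfl

/-- `[folklore]` Unfolding `heatBath`. -/
theorem heatBath_apply (f : ((j : ι) → E j) → ℝ) (ξ : (j : ι) → E j) :
    heatBath q f ξ = (Fintype.card ι : ℝ)⁻¹ * ∑ i, resample q i f ξ := rfl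

variable [∀ i, IsMarkovKernel (q i)]

omit [Fintype ι] in
/-- `[folklore]` `Πᵢ` preserves measurability. -/
theorem measurable_resample (i : ι) {f : ((j : ι) → E j) → ℝ} (hf : Measurable f) :
    Measurable (resample q i f) := by
  have h : StronglyMeasurable (fun p : ((j : ι) → E j) × E i => f (update p.1 i p.2)) :=
    (hf.comp measurable_update').stronglyMeasurable
  exact (h.integral_kernel_prod_right' (κ := q i)).measurable

/-- `[folklore]` `T` preserves measurability. -/
theorem measurable_heatBath {f : ((j : ι) → E j) → ℝ} (hf : Measurable f) :
    Measurable (heatBath q f) :=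
  measurable_const.mul (Finset.measurable_sum _ fun i _ => measurable_resample i hf)

omit [Fintype ι] in
/-- `[folklore]` `Πᵢ` preserves the sup bound. -/
theorem abs_resample_le (i : ι) {f : ((j : ι) → E j) → ℝ} {B : ℝ} (hB : ∀ ξ, |f ξ| ≤ B)
    (ξ : (j : ι) → E j) : |resample q i f ξ| ≤ B :=
  abs_integral_le_of_abs_le (q i ξ) fun _ => hB _

/-- `[folklore]` `T` preserves the sup bound. -/
theorem abs_heatBath_le {f : ((j : ι) → E j) → ℝ} {B : ℝ} (hB : ∀ ξ, |f ξ| ≤ B)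
    (ξ : (j : ι) → E j) : |heatBath q f ξ| ≤ B := by
  rw [heatBath_apply]
  rcases isEmpty_or_nonempty ι with hι | hι
  · simp only [Finset.univ_eq_empty, Finset.sum_empty, mul_zero, abs_zero]
    exact (abs_nonneg _).trans (hB ξ)
  · have hN : (0 : ℝ) < Fintype.card ι := Nat.cast_pos.mpr Fintype.card_pos
    rw [abs_mul, abs_inv, Nat.abs_cast]
    calc (Fintype.card ι : ℝ)⁻¹ * |∑ i, resample q i f ξ|
        ≤ (Fintype.card ι : ℝ)⁻¹ * ∑ i, |resample q i f ξ| := by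
          gcongr; exact Finset.abs_sum_le_sum_abs _ _
      _ ≤ (Fintype.card ι : ℝ)⁻¹ * ∑ _i : ι, B := by
          gcongr with i
          exact abs_resample_le i hB ξ
      _ = B := by
          rw [Finset.sum_const, Finset.card_univ, nsmul_eq_mul, inv_mul_cancel_left₀ hN.ne']

omit [Fintype ι] [∀ i, IsMarkovKernel (q i)] in
/-- `[folklore]` Locality: if `qᵢ` does not read the coordinate it resamples, `Πᵢ f` does not
depend on that coordinate. -/
theorem resample_update (hloc : ∀ (i : ι) (ξ : (j : ι) → E j) (y : E i), q i (update ξ i y) = q i ξ)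
    (i : ι) (f : ((j : ι) → E j) → ℝ) (ξ : (j : ι) → E j) (y : E i) :
    resample q i f (update ξ i y) = resample q i f ξ := by
  simp only [resample_apply, update_idem, hloc]

end Resample


/-! ## §3 Dobrushin's contraction of oscillation vectors -/

section Dobrushin

variable {q : (i : ι) → Kernel ((j : ι) → E j) (E i)} [∀ i, IsMarkovKernel (q i)]
variable {C : ι → ι → ℝ}

/-- `[folklore]` The (oscillation / Kantorovich-dual) form of a DOBRUSHIN INTERDEPENDENCE BOUND: the law
`qᵢ` resampling site `i` depends on the coordinate at site `j ≠ i` by at most `C i j` in total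
variation, tested against bounded measurable `g` of oscillation `≤ D`. -/
def DobrushinBound (q : (i : ι) → Kernel ((j : ι) → E j) (E i)) (C : ι → ι → ℝ) : Prop :=
  ∀ (i j : ι), j ≠ i → ∀ (ξ : (k : ι) → E k) (y y' : E j) (g : E i → ℝ) (B D : ℝ),
    Measurable g → (∀ z, |g z| ≤ B) → (∀ z z', |g z - g z'| ≤ D) →
    |∫ z, g z ∂(q i (update ξ j y)) - ∫ z, g z ∂(q i (update ξ j y'))| ≤ C i j * D

omit [Fintype ι] in
/-- `[folklore]` **Dobrushin bound from two-sided minorisation (overlap / Doeblin form).**  If for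
`j ≠ i` the resampling laws at site `i` for two values of the `j`-th coordinate minorise each
other, `m i j • qᵢ (update ξ j y) ≤ qᵢ (update ξ j y')`, then `C i j := 1 − m i j` is a Dobrushin
interdependence bound in the dual form `DobrushinBound`.  (This is how a two-sided bound on the
RATIO OF CONDITIONAL DENSITIES — e.g. `exp (∓ osc)` of a single-site Gibbs factor — is fed in.) -/
theorem dobrushinBound_of_minorised {m : ι → ι → ℝ} (hm0 : ∀ i j, 0 ≤ m i j)
    (hmin : ∀ (i j : ι), j ≠ i → ∀ (ξ : (k : ι) → E k) (y y' : E j),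
      ENNReal.ofReal (m i j) • q i (update ξ j y) ≤ q i (update ξ j y')) :
    DobrushinBound q (fun i j => 1 - m i j) := by
  intro i j hji ξ y y' g B D hgm hgB hgD
  rcases isEmpty_or_nonempty (E i) with hE | hE
  · exfalso
    have h := measure_univ (μ := q i (update ξ j y))
    rw [Set.univ_eq_empty_iff.mpr hE, measure_empty] at h
    exact zero_ne_one h
  have hbdd : BddBelow (Set.range g) :=
    ⟨-B, by rintro _ ⟨z, rfl⟩; exact (abs_le.mp (hgB z)).1⟩
  set a : ℝ := ⨅ z, g z with ha
  have hga : ∀ z, 0 ≤ g z - a := fun z => sub_nonneg.mpr (ciInf_le hbdd z)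
  have hgaD : ∀ z, g z - a ≤ D := fun z => by
    have h1 : g z - D ≤ a := le_ciInf fun z' => by
      have h2 := hgD z z'
      rw [abs_le] at h2
      linarith
    linarith
  have hgam : Measurable (fun z => g z - a) := hgm.sub_const a
  have hgai : ∀ (ν : Measure (E i)) [IsProbabilityMeasure ν], Integrable (fun z => g z - a) ν :=
    fun ν _ => integrable_of_abs_le_const (μ := ν) hgam.stronglyMeasurable (R := D) fun z => by
      rw [abs_of_nonneg (hga z)]; exact hgaD z
  have hgi : ∀ (ν : Measure (E i)) [IsProbabilityMeasure ν], Integrable g ν :=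
    fun ν _ => integrable_of_abs_le_const (μ := ν) hgm.stronglyMeasurable hgB
  have key : ∀ (ν ν' : Measure (E i)) [IsProbabilityMeasure ν] [IsProbabilityMeasure ν'],
      ENNReal.ofReal (m i j) • ν ≤ ν' → ∫ z, g z ∂ν - ∫ z, g z ∂ν' ≤ (1 - m i j) * D := by
    intro ν ν' _ _ hνν'
    have hm1 : m i j ≤ 1 := by
      have h1 := (Measure.le_iff'.1 hνν') Set.univ
      rw [Measure.smul_apply, measure_univ, measure_univ, smul_eq_mul, mul_one] at h1
      exact ENNReal.ofReal_le_one.mp h1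
    have h1 : ∫ z, g z ∂ν - ∫ z, g z ∂ν' = ∫ z, (g z - a) ∂ν - ∫ z, (g z - a) ∂ν' := by
      rw [integral_sub (hgi ν) (integrable_const a), integral_sub (hgi ν') (integrable_const a),
        integral_const, integral_const, smul_eq_mul, smul_eq_mul, probReal_univ, probReal_univ]
      ring
    have h2 : m i j * ∫ z, (g z - a) ∂ν ≤ ∫ z, (g z - a) ∂ν' := by
      have h3 := integral_mono_measure hνν' (ae_of_all _ hga) (hgai ν')
      rwa [integral_smul_measure, ENNReal.toReal_ofReal (hm0 i j), smul_eq_mul] at h3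
    have h3 : ∫ z, (g z - a) ∂ν ≤ D :=
      (le_abs_self _).trans (abs_integral_le_of_abs_le ν (g := fun z => g z - a) fun z => by
        rw [abs_of_nonneg (hga z)]; exact hgaD z)
    have h4 : 0 ≤ ∫ z, (g z - a) ∂ν := integral_nonneg hga
    rw [h1]
    nlinarith
  exact abs_sub_le_iff.mpr ⟨key _ _ (hmin i j hji ξ y y'), key _ _ (hmin i j hji ξ y' y)⟩

/-- `[folklore]` The site-`i` row of Dobrushin's matrix acting on an oscillation vector:
`(rowVec C i d) j = d j + C i j · d i` off the diagonal, `0` at `j = i`. -/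
def rowVec (C : ι → ι → ℝ) (i : ι) (d : ι → ℝ) : ι → ℝ :=
  fun j => if j = i then 0 else d j + C i j * d i

/-- `[folklore]` Dobrushin's averaged matrix acting on an oscillation vector:
`dobVec C d = (card ι)⁻¹ ∑ᵢ rowVec C i d`. -/
def dobVec (C : ι → ι → ℝ) (d : ι → ℝ) : ι → ℝ :=
  fun j => (Fintype.card ι : ℝ)⁻¹ * ∑ i, rowVec C i d j

omit [Fintype ι] [∀ i, MeasurableSpace (E i)] in
/-- `[folklore]` `rowVec` preserves non-negativity. -/
theorem rowVec_nonneg (hC0 : ∀ i j, 0 ≤ C i j) (i : ι) {d : ι → ℝ} (hd : ∀ j, 0 ≤ d j) (j : ι) :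
    0 ≤ rowVec C i d j := by
  unfold rowVec
  split_ifs
  · exact le_rfl
  · exact add_nonneg (hd j) (mul_nonneg (hC0 i j) (hd i))

omit [∀ i, MeasurableSpace (E i)] in
/-- `[folklore]` `dobVec` preserves non-negativity. -/
theorem dobVec_nonneg (hC0 : ∀ i j, 0 ≤ C i j) {d : ι → ℝ} (hd : ∀ j, 0 ≤ d j) (j : ι) :
    0 ≤ dobVec C d j :=
  mul_nonneg (inv_nonneg.mpr (Nat.cast_nonneg _))
    (Finset.sum_nonneg fun i _ => rowVec_nonneg hC0 i hd j)

omit [∀ i, MeasurableSpace (E i)] in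
/-- `[folklore]` Row-sum identity: `∑ⱼ rowVec C i d j = (∑ⱼ d j − d i) + d i · ∑_{j ≠ i} C i j`. -/
theorem sum_rowVec (i : ι) (d : ι → ℝ) :
    ∑ j, rowVec C i d j = ((∑ j, d j) - d i) + d i * ∑ j ∈ univ.erase i, C i j := by
  have h1 : ∑ j, rowVec C i d j = ∑ j ∈ univ.erase i, rowVec C i d j := by
    rw [← Finset.add_sum_erase _ _ (Finset.mem_univ i)]
    simp [rowVec]
  have h2 : ∑ j ∈ univ.erase i, rowVec C i d j = ∑ j ∈ univ.erase i, (d j + C i j * d i) :=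
    Finset.sum_congr rfl fun j hj => by
      simp [rowVec, Finset.ne_of_mem_erase hj]
  have h3 : ∑ j ∈ univ.erase i, d j = (∑ j, d j) - d i := by
    rw [← Finset.add_sum_erase _ _ (Finset.mem_univ i)]
    ring
  rw [h1, h2, Finset.sum_add_distrib, h3, Finset.mul_sum]
  congr 1
  exact Finset.sum_congr rfl fun j _ => by ring

omit [∀ i, MeasurableSpace (E i)] in
/-- `[folklore]` ℓ¹-CONTRACTION: under the row-sum bound `∑_{j ≠ i} C i j ≤ α` the averaged
Dobrushin matrix contracts the total oscillation by `ρ = 1 − (1 − α)/card ι`. -/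
theorem sum_dobVec_le {α : ℝ}
    (hrow : ∀ i, ∑ j ∈ univ.erase i, C i j ≤ α) {d : ι → ℝ} (hd : ∀ j, 0 ≤ d j) :
    ∑ j, dobVec C d j ≤ (1 - (1 - α) / Fintype.card ι) * ∑ j, d j := by
  rcases isEmpty_or_nonempty ι with hι | hι
  · simp
  have hN : (0 : ℝ) < Fintype.card ι := Nat.cast_pos.mpr Fintype.card_pos
  unfold dobVec
  rw [← Finset.mul_sum, Finset.sum_comm]
  have h1 : ∀ i, ∑ j, rowVec C i d j ≤ ((∑ j, d j) - d i) + d i * α := fun i => by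
    rw [sum_rowVec]
    gcongr
    · exact hd i
    · exact hrow i
  calc (Fintype.card ι : ℝ)⁻¹ * ∑ i, ∑ j, rowVec C i d j
      ≤ (Fintype.card ι : ℝ)⁻¹ * ∑ i, (((∑ j, d j) - d i) + d i * α) := by
        gcongr with i
        exact h1 i
    _ = (1 - (1 - α) / Fintype.card ι) * ∑ j, d j := by
        rw [Finset.sum_add_distrib, Finset.sum_sub_distrib, Finset.sum_const, Finset.card_univ,
          nsmul_eq_mul, ← Finset.sum_mul]
        field_simp
        ring

omit [Fintype ι] in
/-- `[folklore]` ONE SITE: the oscillation vector of `Πᵢ f` is `rowVec C i d`.  Locality makes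
`Πᵢ f` independent of the `i`-th coordinate; for `j ≠ i` the change of `ξⱼ` moves the integrand
by `d j` (at fixed resampling law) and the resampling law by `C i j` in the dual-TV sense,
tested against an integrand of oscillation `d i`. -/
theorem oscBound_resample
    (hloc : ∀ (i : ι) (ξ : (j : ι) → E j) (y : E i), q i (update ξ i y) = q i ξ)
    (hC : DobrushinBound q C) (i : ι) {f : ((j : ι) → E j) → ℝ} {d : ι → ℝ} {B : ℝ}
    (hfm : Measurable f) (hB : ∀ ξ, |f ξ| ≤ B) (hf : OscBound f d) :
    OscBound (resample q i f) (rowVec C i d) := by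
  intro j ξ y y'
  by_cases hji : j = i
  · subst hji
    simp only [rowVec, if_true]
    rw [resample_update hloc, resample_update hloc, sub_self, abs_zero]
  · simp only [rowVec, hji, if_false]
    have hA : ∀ z : E i,
        |f (update (update ξ j y) i z) - f (update (update ξ j y') i z)| ≤ d j := fun z => by
      rw [update_comm hji y z ξ, update_comm hji y' z ξ]
      exact hf j (update ξ i z) y y'
    have hint : ∀ (w : E j), Integrable (fun z : E i => f (update (update ξ j w) i z))
        (q i (update ξ j y)) := fun w =>
      integrable_of_abs_le_const (hfm.comp (measurable_update _)).stronglyMeasurable fun z => hB _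
    have h1 : |∫ z, f (update (update ξ j y) i z) ∂(q i (update ξ j y))
        - ∫ z, f (update (update ξ j y') i z) ∂(q i (update ξ j y))| ≤ d j := by
      rw [← integral_sub (hint y) (hint y')]
      exact abs_integral_le_of_abs_le _ hA
    have h2 : |∫ z, f (update (update ξ j y') i z) ∂(q i (update ξ j y))
        - ∫ z, f (update (update ξ j y') i z) ∂(q i (update ξ j y'))| ≤ C i j * d i :=
      hC i j hji ξ y y' (fun z => f (update (update ξ j y') i z)) B (d i)
        (hfm.comp (measurable_update _)) (fun z => hB _) (fun z z' => hf i (update ξ j y') z z')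
    calc |resample q i f (update ξ j y) - resample q i f (update ξ j y')|
        = |(∫ z, f (update (update ξ j y) i z) ∂(q i (update ξ j y))
              - ∫ z, f (update (update ξ j y') i z) ∂(q i (update ξ j y)))
            + (∫ z, f (update (update ξ j y') i z) ∂(q i (update ξ j y))
              - ∫ z, f (update (update ξ j y') i z) ∂(q i (update ξ j y')))| := by
          simp only [resample_apply, sub_add_sub_cancel]
      _ ≤ _ := abs_add_le _ _
      _ ≤ d j + C i j * d i := add_le_add h1 h2

/-- `[folklore]` HEAT BATH: the oscillation vector of `T f` is `dobVec C d`. -/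
theorem oscBound_heatBath
    (hloc : ∀ (i : ι) (ξ : (j : ι) → E j) (y : E i), q i (update ξ i y) = q i ξ)
    (hC : DobrushinBound q C) {f : ((j : ι) → E j) → ℝ} {d : ι → ℝ} {B : ℝ}
    (hfm : Measurable f) (hB : ∀ ξ, |f ξ| ≤ B) (hf : OscBound f d) :
    OscBound (heatBath q f) (dobVec C d) := by
  intro j ξ y y'
  simp only [heatBath_apply, dobVec]
  rw [← mul_sub, ← Finset.sum_sub_distrib, abs_mul, abs_inv, Nat.abs_cast]
  gcongr
  calc |∑ i, (resample q i f (update ξ j y) - resample q i f (update ξ j y'))|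
      ≤ ∑ i, |resample q i f (update ξ j y) - resample q i f (update ξ j y')| :=
        Finset.abs_sum_le_sum_abs _ _
    _ ≤ ∑ i, rowVec C i d j :=
        Finset.sum_le_sum fun i _ => (oscBound_resample hloc hC i hfm hB hf) j ξ y y'

/-- `[folklore]` ITERATION: `T^[n] f` is measurable, bounded by the same `B`, and has an
oscillation vector of total mass `≤ ρ ^ n · (2 B · card ι)`, `ρ = 1 − (1 − α)/card ι`. -/
theorem iterate_heatBath_osc
    (hloc : ∀ (i : ι) (ξ : (j : ι) → E j) (y : E i), q i (update ξ i y) = q i ξ)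
    (hC0 : ∀ i j, 0 ≤ C i j) (hC : DobrushinBound q C) {α : ℝ} (hα0 : 0 ≤ α)
    (hrow : ∀ i, ∑ j ∈ univ.erase i, C i j ≤ α)
    {f : ((j : ι) → E j) → ℝ} {B : ℝ} (hB0 : 0 ≤ B) (hfm : Measurable f) (hB : ∀ ξ, |f ξ| ≤ B)
    (n : ℕ) :
    Measurable ((heatBath q)^[n] f) ∧ (∀ ξ, |(heatBath q)^[n] f ξ| ≤ B) ∧
      ∃ d : ι → ℝ, (∀ j, 0 ≤ d j) ∧ OscBound ((heatBath q)^[n] f) d ∧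
        ∑ j, d j ≤ (1 - (1 - α) / Fintype.card ι) ^ n * (2 * B * Fintype.card ι) := by
  have hρ0 : 0 ≤ 1 - (1 - α) / (Fintype.card ι : ℝ) := by
    rcases isEmpty_or_nonempty ι with hι | hι
    · simp
    · have hN : (1 : ℝ) ≤ Fintype.card ι := by exact_mod_cast Fintype.card_pos
      have hN' : (0 : ℝ) < Fintype.card ι := by linarith
      rw [sub_nonneg, div_le_one hN']
      linarith
  induction n with
  | zero =>
    refine ⟨hfm, hB, fun _ => 2 * B, fun _ => by linarith, oscBound_of_abs_le hB, ?_⟩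
    rw [pow_zero, one_mul, Finset.sum_const, Finset.card_univ, nsmul_eq_mul]
    exact le_of_eq (by ring)
  | succ n ih =>
    obtain ⟨hm, hb, d, hd0, hosc, hsum⟩ := ih
    rw [Function.iterate_succ_apply']
    refine ⟨measurable_heatBath hm, abs_heatBath_le hb, dobVec C d, dobVec_nonneg hC0 hd0,
      oscBound_heatBath hloc hC hm hb hosc, ?_⟩
    calc ∑ j, dobVec C d j ≤ (1 - (1 - α) / Fintype.card ι) * ∑ j, d j :=
          sum_dobVec_le hrow hd0
      _ ≤ (1 - (1 - α) / Fintype.card ι)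
            * ((1 - (1 - α) / Fintype.card ι) ^ n * (2 * B * Fintype.card ι)) :=
          mul_le_mul_of_nonneg_left hsum hρ0
      _ = (1 - (1 - α) / Fintype.card ι) ^ (n + 1) * (2 * B * Fintype.card ι) := by ring

end Dobrushin


/-! ## §4 Resampling invariance: mean preservation, symmetry, the Dirichlet form -/

section Symmetry

variable {q : (i : ι) → Kernel ((j : ι) → E j) (E i)} [∀ i, IsMarkovKernel (q i)]
variable {Q : Measure ((j : ι) → E j)} [IsProbabilityMeasure Q]

/-- `[folklore]` RESAMPLING INVARIANCE of `Q` under the single-site kernels: resampling the `i`-th coordinate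
from `qᵢ ξ` does not change `Q`-expectations of bounded measurable functions (i.e. `qᵢ` is a
version of the conditional law under `Q` of the `i`-th coordinate given the others). -/
def ResamplingInvariant (Q : Measure ((j : ι) → E j)) (q : (i : ι) → Kernel ((j : ι) → E j) (E i)) :
    Prop :=
  ∀ (i : ι) (F : ((j : ι) → E j) → ℝ) (B : ℝ), Measurable F → (∀ ξ, |F ξ| ≤ B) →
    ∫ ξ, (∫ y, F (update ξ i y) ∂(q i ξ)) ∂Q = ∫ ξ, F ξ ∂Q

omit [Fintype ι] [∀ i, IsMarkovKernel (q i)] [IsProbabilityMeasure Q] in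
/-- `[folklore]` `∫ Πᵢ f dQ = ∫ f dQ`. -/
theorem integral_resample_eq (hinv : ResamplingInvariant Q q) (i : ι)
    {f : ((j : ι) → E j) → ℝ} {B : ℝ} (hfm : Measurable f) (hB : ∀ ξ, |f ξ| ≤ B) :
    ∫ ξ, resample q i f ξ ∂Q = ∫ ξ, f ξ ∂Q :=
  hinv i f B hfm hB

/-- `[folklore]` `T^[n] f` is measurable. -/
theorem measurable_iterate_heatBath (n : ℕ) {f : ((j : ι) → E j) → ℝ} (hfm : Measurable f) :
    Measurable ((heatBath q)^[n] f) := by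
  induction n with
  | zero => exact hfm
  | succ n ih => rw [Function.iterate_succ_apply']; exact measurable_heatBath ih

/-- `[folklore]` `T^[n] f` keeps the sup bound. -/
theorem abs_iterate_heatBath_le (n : ℕ) {f : ((j : ι) → E j) → ℝ} {B : ℝ} (hB : ∀ ξ, |f ξ| ≤ B) :
    ∀ ξ, |(heatBath q)^[n] f ξ| ≤ B := by
  induction n with
  | zero => exact hB
  | succ n ih => rw [Function.iterate_succ_apply']; exact abs_heatBath_le ih

/-- `[folklore]` MEAN PRESERVATION: `∫ T f dQ = ∫ f dQ`. -/
theorem integral_heatBath_eq [Nonempty ι] (hinv : ResamplingInvariant Q q)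
    {f : ((j : ι) → E j) → ℝ} {B : ℝ} (hfm : Measurable f) (hB : ∀ ξ, |f ξ| ≤ B) :
    ∫ ξ, heatBath q f ξ ∂Q = ∫ ξ, f ξ ∂Q := by
  have hN : (Fintype.card ι : ℝ) ≠ 0 := Nat.cast_ne_zero.mpr Fintype.card_ne_zero
  have hint : ∀ i ∈ (univ : Finset ι), Integrable (fun ξ => resample q i f ξ) Q := fun i _ =>
    integrable_of_abs_le_const (μ := Q) (measurable_resample i hfm).stronglyMeasurable
      (abs_resample_le i hB)
  simp only [heatBath_apply]
  rw [integral_const_mul, integral_finsetSum _ hint]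
  simp_rw [integral_resample_eq hinv _ hfm hB]
  rw [Finset.sum_const, Finset.card_univ, nsmul_eq_mul, inv_mul_cancel_left₀ hN]

/-- `[folklore]` `∫ T^[n] f dQ = ∫ f dQ`. -/
theorem integral_iterate_heatBath_eq [Nonempty ι] (hinv : ResamplingInvariant Q q) (n : ℕ)
    {f : ((j : ι) → E j) → ℝ} {B : ℝ} (hfm : Measurable f) (hB : ∀ ξ, |f ξ| ≤ B) :
    ∫ ξ, (heatBath q)^[n] f ξ ∂Q = ∫ ξ, f ξ ∂Q := by
  induction n with
  | zero => rfl
  | succ n ih =>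
    rw [Function.iterate_succ_apply',
      integral_heatBath_eq hinv (measurable_iterate_heatBath n hfm) (abs_iterate_heatBath_le n hB)]
    exact ih

omit [Fintype ι] [IsProbabilityMeasure Q] in
/-- `[folklore]` ONE-SITE SYMMETRY: `∫ g · Πᵢ f dQ = ∫ Πᵢ g · Πᵢ f dQ` (locality + resampling
invariance applied to `F = g · Πᵢ f`, using that `Πᵢ f` does not depend on the resampled
coordinate). -/
theorem integral_mul_resample_symm
    (hloc : ∀ (i : ι) (ξ : (j : ι) → E j) (y : E i), q i (update ξ i y) = q i ξ)
    (hinv : ResamplingInvariant Q q) (i : ι)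
    {f g : ((j : ι) → E j) → ℝ} {Bf Bg : ℝ} (hfm : Measurable f) (hBf : ∀ ξ, |f ξ| ≤ Bf)
    (hgm : Measurable g) (hBg : ∀ ξ, |g ξ| ≤ Bg) :
    ∫ ξ, g ξ * resample q i f ξ ∂Q = ∫ ξ, resample q i g ξ * resample q i f ξ ∂Q := by
  have hF : ∫ ξ, (∫ y, g (update ξ i y) * resample q i f (update ξ i y) ∂(q i ξ)) ∂Q
      = ∫ ξ, g ξ * resample q i f ξ ∂Q :=
    hinv i (fun ξ => g ξ * resample q i f ξ) (Bg * Bf) (hgm.mul (measurable_resample i hfm))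
      (fun ξ => by
        rw [abs_mul]
        exact mul_le_mul (hBg ξ) (abs_resample_le i hBf ξ) (abs_nonneg _)
          ((abs_nonneg _).trans (hBg ξ)))
  rw [← hF]
  refine integral_congr_ae (Filter.Eventually.of_forall fun ξ => ?_)
  simp only [resample_update hloc, integral_mul_const]
  rfl

omit [Fintype ι] [IsProbabilityMeasure Q] in
/-- `[folklore]` `∫ g · Πᵢ f dQ = ∫ Πᵢ g · f dQ`. -/
theorem integral_mul_resample_comm
    (hloc : ∀ (i : ι) (ξ : (j : ι) → E j) (y : E i), q i (update ξ i y) = q i ξ)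
    (hinv : ResamplingInvariant Q q) (i : ι)
    {f g : ((j : ι) → E j) → ℝ} {Bf Bg : ℝ} (hfm : Measurable f) (hBf : ∀ ξ, |f ξ| ≤ Bf)
    (hgm : Measurable g) (hBg : ∀ ξ, |g ξ| ≤ Bg) :
    ∫ ξ, g ξ * resample q i f ξ ∂Q = ∫ ξ, resample q i g ξ * f ξ ∂Q := by
  rw [integral_mul_resample_symm hloc hinv i hfm hBf hgm hBg]
  have h := integral_mul_resample_symm hloc hinv i hgm hBg hfm hBf
  simp_rw [mul_comm (f _)] at h
  rw [h]
  simp_rw [mul_comm]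

/-- `[folklore]` `Q`-SYMMETRY OF THE HEAT BATH: `∫ g · T f dQ = ∫ T g · f dQ`. -/
theorem integral_mul_heatBath_comm
    (hloc : ∀ (i : ι) (ξ : (j : ι) → E j) (y : E i), q i (update ξ i y) = q i ξ)
    (hinv : ResamplingInvariant Q q)
    {f g : ((j : ι) → E j) → ℝ} {Bf Bg : ℝ} (hfm : Measurable f) (hBf : ∀ ξ, |f ξ| ≤ Bf)
    (hgm : Measurable g) (hBg : ∀ ξ, |g ξ| ≤ Bg) :
    ∫ ξ, g ξ * heatBath q f ξ ∂Q = ∫ ξ, heatBath q g ξ * f ξ ∂Q := by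
  have hBg0 : ∀ ξ : (j : ι) → E j, 0 ≤ Bg := fun ξ => (abs_nonneg _).trans (hBg ξ)
  have hBf0 : ∀ ξ : (j : ι) → E j, 0 ≤ Bf := fun ξ => (abs_nonneg _).trans (hBf ξ)
  have h1 : ∀ ξ, g ξ * heatBath q f ξ = (Fintype.card ι : ℝ)⁻¹ * ∑ i, g ξ * resample q i f ξ :=
    fun ξ => by rw [heatBath_apply, ← Finset.mul_sum]; ring
  have h2 : ∀ ξ, heatBath q g ξ * f ξ = (Fintype.card ι : ℝ)⁻¹ * ∑ i, resample q i g ξ * f ξ :=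
    fun ξ => by rw [heatBath_apply, ← Finset.sum_mul]; ring
  have hint1 : ∀ i ∈ (univ : Finset ι), Integrable (fun ξ => g ξ * resample q i f ξ) Q :=
    fun i _ => by
      have hm : Measurable (fun ξ => g ξ * resample q i f ξ) := hgm.mul (measurable_resample i hfm)
      exact integrable_of_abs_le_const (μ := Q) hm.stronglyMeasurable (R := Bg * Bf) fun ξ => by
        rw [abs_mul]
        exact mul_le_mul (hBg ξ) (abs_resample_le i hBf ξ) (abs_nonneg _) (hBg0 ξ)
  have hint2 : ∀ i ∈ (univ : Finset ι), Integrable (fun ξ => resample q i g ξ * f ξ) Q :=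
    fun i _ => by
      have hm : Measurable (fun ξ => resample q i g ξ * f ξ) := (measurable_resample i hgm).mul hfm
      exact integrable_of_abs_le_const (μ := Q) hm.stronglyMeasurable (R := Bg * Bf) fun ξ => by
        rw [abs_mul]
        exact mul_le_mul (abs_resample_le i hBg ξ) (hBf ξ) (abs_nonneg _) (hBg0 ξ)
  simp_rw [h1, h2]
  rw [integral_const_mul, integral_const_mul, integral_finsetSum _ hint1,
    integral_finsetSum _ hint2]
  exact congrArg _ (Finset.sum_congr rfl fun i _ =>
    integral_mul_resample_comm hloc hinv i hfm hBf hgm hBg)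

/-- `[folklore]` `∫ T^[m] f · T^[k] f dQ = ∫ f · T^[m + k] f dQ`. -/
theorem integral_iterate_mul_iterate
    (hloc : ∀ (i : ι) (ξ : (j : ι) → E j) (y : E i), q i (update ξ i y) = q i ξ)
    (hinv : ResamplingInvariant Q q)
    {f : ((j : ι) → E j) → ℝ} {B : ℝ} (hfm : Measurable f) (hB : ∀ ξ, |f ξ| ≤ B) :
    ∀ (m k : ℕ), ∫ ξ, (heatBath q)^[m] f ξ * (heatBath q)^[k] f ξ ∂Q
      = ∫ ξ, f ξ * (heatBath q)^[m + k] f ξ ∂Q := by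
  intro m
  induction m with
  | zero => intro k; simp
  | succ m ih =>
    intro k
    have h1 : m + 1 + k = m + (k + 1) := by omega
    rw [h1, ← ih (k + 1), Function.iterate_succ_apply', Function.iterate_succ_apply']
    exact (integral_mul_heatBath_comm hloc hinv (measurable_iterate_heatBath k hfm)
      (abs_iterate_heatBath_le k hB) (measurable_iterate_heatBath m hfm)
      (abs_iterate_heatBath_le m hB)).symm

omit [Fintype ι] in
/-- `[folklore]` ONE-SITE DIRICHLET FORM:
`∫ f · (f − Πᵢ f) dQ = ½ ∫∫ (f ξ − f (update ξ i y))² dqᵢ dQ`. -/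
theorem integral_mul_sub_resample (hinv : ResamplingInvariant Q q) (i : ι)
    {f : ((j : ι) → E j) → ℝ} {B : ℝ} (hfm : Measurable f) (hB : ∀ ξ, |f ξ| ≤ B) :
    ∫ ξ, f ξ * (f ξ - resample q i f ξ) ∂Q
      = (1 / 2 : ℝ) * ∫ ξ, (∫ y, (f ξ - f (update ξ i y)) ^ 2 ∂(q i ξ)) ∂Q := by
  have hB2 : ∀ ξ, |f ξ ^ 2| ≤ B ^ 2 := fun ξ => by
    rw [abs_pow]; exact pow_le_pow_left₀ (abs_nonneg _) (hB ξ) 2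
  have hpt : ∀ ξ, ∫ y, (f ξ - f (update ξ i y)) ^ 2 ∂(q i ξ)
      = f ξ ^ 2 - 2 * (f ξ * resample q i f ξ) + resample q i (fun ζ => f ζ ^ 2) ξ := by
    intro ξ
    have h1 : ∀ y, (f ξ - f (update ξ i y)) ^ 2
        = (f ξ ^ 2 - (2 * f ξ) * f (update ξ i y)) + f (update ξ i y) ^ 2 := fun y => by ring
    simp_rw [h1]
    have hi1 : Integrable (fun y => f (update ξ i y)) (q i ξ) :=
      integrable_of_abs_le_const (hfm.comp (measurable_update _)).stronglyMeasurable fun y => hB _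
    have hi2 : Integrable (fun y => f (update ξ i y) ^ 2) (q i ξ) :=
      integrable_of_abs_le_const ((hfm.comp (measurable_update _)).pow_const 2).stronglyMeasurable fun y => hB2 _
    have hi3 : Integrable (fun y => f ξ ^ 2 - (2 * f ξ) * f (update ξ i y)) (q i ξ) :=
      (integrable_const _).sub (hi1.const_mul _)
    rw [integral_add hi3 hi2, integral_sub (integrable_const _) (hi1.const_mul _),
      integral_const_mul, integral_const, smul_eq_mul, probReal_univ, one_mul, resample_apply,
      resample_apply]
    ring
  simp_rw [hpt]
  have hI1 : Integrable (fun ξ => f ξ ^ 2) Q :=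
    integrable_of_abs_le_const (μ := Q) (hfm.pow_const 2).stronglyMeasurable hB2
  have hI2m : Measurable (fun ξ => f ξ * resample q i f ξ) := hfm.mul (measurable_resample i hfm)
  have hI2 : Integrable (fun ξ => f ξ * resample q i f ξ) Q :=
    integrable_of_abs_le_const (μ := Q) hI2m.stronglyMeasurable (R := B * B) fun ξ => by
      rw [abs_mul]
      exact mul_le_mul (hB ξ) (abs_resample_le i hB ξ) (abs_nonneg _)
        ((abs_nonneg _).trans (hB ξ))
  have hI3 : Integrable (resample q i (fun ζ => f ζ ^ 2)) Q :=
    integrable_of_abs_le_const (μ := Q) (measurable_resample i (hfm.pow_const 2)).stronglyMeasurable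
      (abs_resample_le i hB2)
  have hinv2 : ∫ ξ, resample q i (fun ζ => f ζ ^ 2) ξ ∂Q = ∫ ξ, f ξ ^ 2 ∂Q :=
    hinv i (fun ζ => f ζ ^ 2) (B ^ 2) (hfm.pow_const 2) hB2
  have hL : ∫ ξ, f ξ * (f ξ - resample q i f ξ) ∂Q
      = ∫ ξ, f ξ ^ 2 ∂Q - ∫ ξ, f ξ * resample q i f ξ ∂Q := by
    rw [← integral_sub hI1 hI2]
    refine integral_congr_ae (Filter.Eventually.of_forall fun ξ => ?_)
    ring
  have hI4 : Integrable (fun ξ => f ξ ^ 2 - 2 * (f ξ * resample q i f ξ)) Q :=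
    hI1.sub (hI2.const_mul _)
  rw [hL, integral_add hI4 hI3, integral_sub hI1 (hI2.const_mul _), integral_const_mul, hinv2]
  ring

/-- `[folklore]` HEAT-BATH DIRICHLET FORM:
`∫ f · (f − T f) dQ = (card ι)⁻¹ ∑ᵢ ½ ∫∫ (f ξ − f (update ξ i y))² dqᵢ dQ`. -/
theorem integral_mul_sub_heatBath [Nonempty ι] (hinv : ResamplingInvariant Q q)
    {f : ((j : ι) → E j) → ℝ} {B : ℝ} (hfm : Measurable f) (hB : ∀ ξ, |f ξ| ≤ B) :
    ∫ ξ, f ξ * (f ξ - heatBath q f ξ) ∂Q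
      = (Fintype.card ι : ℝ)⁻¹ *
          ∑ i, ((1 / 2 : ℝ) * ∫ ξ, (∫ y, (f ξ - f (update ξ i y)) ^ 2 ∂(q i ξ)) ∂Q) := by
  have hN : (Fintype.card ι : ℝ) ≠ 0 := Nat.cast_ne_zero.mpr Fintype.card_ne_zero
  have hpt : ∀ ξ, f ξ * (f ξ - heatBath q f ξ)
      = (Fintype.card ι : ℝ)⁻¹ * ∑ i, f ξ * (f ξ - resample q i f ξ) := by
    intro ξ
    have h1 : f ξ - heatBath q f ξ = (Fintype.card ι : ℝ)⁻¹ * ∑ i, (f ξ - resample q i f ξ) := by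
      rw [Finset.sum_sub_distrib, Finset.sum_const, Finset.card_univ, nsmul_eq_mul, mul_sub,
        ← mul_assoc, inv_mul_cancel₀ hN, one_mul, heatBath_apply]
    rw [h1, mul_left_comm, Finset.mul_sum]
  have hint : ∀ i ∈ (univ : Finset ι), Integrable (fun ξ => f ξ * (f ξ - resample q i f ξ)) Q :=
    fun i _ => by
      have hm : Measurable (fun ξ => f ξ * (f ξ - resample q i f ξ)) :=
        hfm.mul (hfm.sub (measurable_resample i hfm))
      exact integrable_of_abs_le_const (μ := Q) hm.stronglyMeasurable (R := B * (B + B)) fun ξ => by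
        rw [abs_mul]
        exact mul_le_mul (hB ξ) ((abs_sub _ _).trans (add_le_add (hB ξ) (abs_resample_le i hB ξ)))
          (abs_nonneg _) ((abs_nonneg _).trans (hB ξ))
  simp_rw [hpt]
  rw [integral_const_mul, integral_finsetSum _ hint]
  exact congrArg _ (Finset.sum_congr rfl fun i _ => integral_mul_sub_resample hinv i hfm hB)

end Symmetry

/-! ## §5 The Poincaré inequality for the heat bath and the tensorised Efron–Stein inequality -/

section Main

variable {q : (i : ι) → Kernel ((j : ι) → E j) (E i)} [∀ i, IsMarkovKernel (q i)]
variable {Q : Measure ((j : ι) → E j)} [IsProbabilityMeasure Q] {C : ι → ι → ℝ}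

/-- `[folklore]` CONTRACTION OF THE HEAT BATH ON CENTRED FUNCTIONS:
`∫ f · T f dQ ≤ ρ ∫ f² dQ`, `ρ = 1 − (1 − α)/card ι`, for `Q`-centred bounded measurable `f`.
Proof: `bₙ = ∫ (T^n f)² dQ` is log-convex (symmetry + Cauchy–Schwarz) and `≤ K ρ^{2n}`
(oscillation contraction + centring), hence `b₁ ≤ ρ² b₀` (`ratio_le_of_logConvex_of_le_geometric`);
then Cauchy–Schwarz once more. -/
theorem integral_mul_heatBath_le [Nonempty ι]
    (hloc : ∀ (i : ι) (ξ : (j : ι) → E j) (y : E i), q i (update ξ i y) = q i ξ)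
    (hinv : ResamplingInvariant Q q) (hC0 : ∀ i j, 0 ≤ C i j) (hC : DobrushinBound q C)
    {α : ℝ} (hα0 : 0 ≤ α) (hrow : ∀ i, ∑ j ∈ univ.erase i, C i j ≤ α)
    {f : ((j : ι) → E j) → ℝ} {B : ℝ} (hB0 : 0 ≤ B) (hfm : Measurable f) (hB : ∀ ξ, |f ξ| ≤ B)
    (h0 : ∫ ξ, f ξ ∂Q = 0) :
    ∫ ξ, f ξ * heatBath q f ξ ∂Q ≤ (1 - (1 - α) / Fintype.card ι) * ∫ ξ, f ξ ^ 2 ∂Q := by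
  set ρ : ℝ := 1 - (1 - α) / Fintype.card ι with hρ
  have hρ0 : 0 ≤ ρ := by
    have hN : (1 : ℝ) ≤ Fintype.card ι := by exact_mod_cast Fintype.card_pos
    have hN' : (0 : ℝ) < Fintype.card ι := by linarith
    rw [hρ, sub_nonneg, div_le_one hN']
    linarith
  set b : ℕ → ℝ := fun n => ∫ ξ, ((heatBath q)^[n] f ξ) ^ 2 ∂Q with hb
  have hmeas : ∀ n, Measurable ((heatBath q)^[n] f) := fun n => measurable_iterate_heatBath n hfm
  have hbdd : ∀ n ξ, |(heatBath q)^[n] f ξ| ≤ B := fun n => abs_iterate_heatBath_le n hB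
  have hcen : ∀ n, ∫ ξ, (heatBath q)^[n] f ξ ∂Q = 0 := fun n => by
    rw [integral_iterate_heatBath_eq hinv n hfm hB, h0]
  have hsup : ∀ n ξ, |(heatBath q)^[n] f ξ| ≤ ρ ^ n * (2 * B * Fintype.card ι) := fun n ξ => by
    obtain ⟨-, -, d, -, hosc, hsum⟩ := iterate_heatBath_osc hloc hC0 hC hα0 hrow hB0 hfm hB n
    exact (hosc.abs_le_sum_of_integral_eq_zero Q
      (integrable_of_abs_le_const (μ := Q) (hmeas n).stronglyMeasurable (hbdd n))
      (hcen n) ξ).trans hsum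
  have hbeq : ∀ n, b n = ∫ ξ, f ξ * (heatBath q)^[2 * n] f ξ ∂Q := fun n => by
    simp only [hb, sq]
    rw [integral_iterate_mul_iterate hloc hinv hfm hB n n, two_mul]
  have hK : ∀ n, b n ≤ (B * (2 * B * Fintype.card ι)) * (ρ ^ 2) ^ n := fun n => by
    rw [hbeq n, ← pow_mul]
    calc ∫ ξ, f ξ * (heatBath q)^[2 * n] f ξ ∂Q
        ≤ |∫ ξ, f ξ * (heatBath q)^[2 * n] f ξ ∂Q| := le_abs_self _
      _ ≤ B * (ρ ^ (2 * n) * (2 * B * Fintype.card ι)) :=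
          abs_integral_le_of_abs_le Q fun ξ => by
            rw [abs_mul]
            exact mul_le_mul (hB ξ) (hsup (2 * n) ξ) (abs_nonneg _) hB0
      _ = (B * (2 * B * Fintype.card ι)) * ρ ^ (2 * n) := by ring
  have hlc : ∀ n, b (n + 1) ^ 2 ≤ b n * b (n + 2) := fun n => by
    have h1 : b (n + 1) = ∫ ξ, (heatBath q)^[n] f ξ * (heatBath q)^[n + 2] f ξ ∂Q := by
      simp only [hb, sq]
      have h2 : n + 1 + (n + 1) = n + (n + 2) := by omega
      rw [integral_iterate_mul_iterate hloc hinv hfm hB (n + 1) (n + 1),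
        integral_iterate_mul_iterate hloc hinv hfm hB n (n + 2), h2]
    rw [h1]
    exact sq_integral_mul_le Q (hmeas n) (hmeas (n + 2)) (hbdd n) (hbdd (n + 2))
  have hb0 : ∀ n, 0 ≤ b n := fun n => integral_nonneg fun ξ => sq_nonneg _
  have hmain := ratio_le_of_logConvex_of_le_geometric hb0 hlc (sq_nonneg ρ) hK
  have hCS : (∫ ξ, f ξ * heatBath q f ξ ∂Q) ^ 2 ≤ b 0 * b 1 := by
    have h := sq_integral_mul_le Q hfm (measurable_heatBath (q := q) hfm) hB
      (abs_heatBath_le (q := q) hB)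
    simpa [hb] using h
  have hb0eq : b 0 = ∫ ξ, f ξ ^ 2 ∂Q := by simp [hb]
  have hsq : (∫ ξ, f ξ * heatBath q f ξ ∂Q) ^ 2 ≤ (ρ * b 0) ^ 2 :=
    calc _ ≤ b 0 * b 1 := hCS
      _ ≤ b 0 * (ρ ^ 2 * b 0) := mul_le_mul_of_nonneg_left hmain (hb0 0)
      _ = (ρ * b 0) ^ 2 := by ring
  have h := abs_le_of_sq_le_sq' hsq (mul_nonneg hρ0 (hb0 0))
  rw [hb0eq] at h
  exact h.2

/-- **Dobrushin's row-sum condition ⇒ the tensorised Efron–Stein inequality** (`[folklore]`,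
kernel-proved).  For a probability law `Q` on `(i : ι) → E i` and single-site Markov kernels
`qᵢ` which are LOCAL (`hloc`), RESAMPLING-INVARIANT for `Q` (`hinv`) and satisfy a DOBRUSHIN
INTERDEPENDENCE BOUND (`hC`, in dual-TV / oscillation form) with row sums
`∑_{j ≠ i} C i j ≤ α < 1` (`hrow`), every bounded measurable `G` satisfies

  `Var_Q G ≤ (1 − α)⁻¹ · ½ ∑ᵢ ∫∫ (G ξ − G (update ξ i y))² d(qᵢ ξ)(y) dQ(ξ)`.

The conclusion is verbatim the hypothesis shape `hES` of
`T4CouplingIncoherence.oneStepVar_le_of_rep_efronSteinWith` with `CT := 1 / (1 - α)`. -/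
theorem efronSteinWith_of_dobrushin (Q : Measure ((i : ι) → E i)) [IsProbabilityMeasure Q]
    (q : (i : ι) → Kernel ((j : ι) → E j) (E i)) [∀ i, IsMarkovKernel (q i)]
    (hloc : ∀ (i : ι) (ξ : (j : ι) → E j) (y : E i), q i (update ξ i y) = q i ξ)
    (hinv : ∀ (i : ι) (F : ((j : ι) → E j) → ℝ) (B : ℝ), Measurable F → (∀ ξ, |F ξ| ≤ B) →
      ∫ ξ, (∫ y, F (update ξ i y) ∂(q i ξ)) ∂Q = ∫ ξ, F ξ ∂Q)
    (C : ι → ι → ℝ) (hC0 : ∀ i j, 0 ≤ C i j)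
    (hC : ∀ (i j : ι), j ≠ i → ∀ (ξ : (k : ι) → E k) (y y' : E j) (g : E i → ℝ) (B D : ℝ),
      Measurable g → (∀ z, |g z| ≤ B) → (∀ z z', |g z - g z'| ≤ D) →
      |∫ z, g z ∂(q i (update ξ j y)) - ∫ z, g z ∂(q i (update ξ j y'))| ≤ C i j * D)
    {α : ℝ} (hα : α < 1) (hrow : ∀ i, ∑ j ∈ univ.erase i, C i j ≤ α) :
    ∀ (G : ((i : ι) → E i) → ℝ) (B : ℝ), Measurable G → (∀ ξ, |G ξ| ≤ B) →
      ∫ ξ, (G ξ - ∫ ζ, G ζ ∂Q) ^ 2 ∂Q ≤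
        (1 / (1 - α)) *
          ((1 / 2 : ℝ) * ∑ i, ∫ ξ, (∫ y, (G ξ - G (update ξ i y)) ^ 2 ∂(q i ξ)) ∂Q) := by
  intro G B hGm hGB
  rcases isEmpty_or_nonempty ι with hι | hι
  · have hc : ∀ ξ, G ξ - ∫ ζ, G ζ ∂Q = 0 := fun ξ => by
      have h1 : (fun ζ => G ζ) = fun _ => G ξ := funext fun ζ => congrArg G (Subsingleton.elim ζ ξ)
      rw [h1, integral_const, smul_eq_mul, probReal_univ, one_mul, sub_self]
    simp_rw [hc]
    simp
  have hα0 : 0 ≤ α := by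
    obtain ⟨i⟩ := hι
    exact (Finset.sum_nonneg fun j _ => hC0 i j).trans (hrow i)
  have h1α : 0 < 1 - α := by linarith
  have hN : (0 : ℝ) < Fintype.card ι := Nat.cast_pos.mpr Fintype.card_pos
  set c : ℝ := ∫ ζ, G ζ ∂Q with hc
  set f : ((j : ι) → E j) → ℝ := fun ξ => G ξ - c with hf
  have hfm : Measurable f := hGm.sub_const c
  have hB' : ∀ ξ, |G ξ| ≤ |B| := fun ξ => (hGB ξ).trans (le_abs_self B)
  have hcB : |c| ≤ |B| := abs_integral_le_of_abs_le Q hB'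
  have hfB : ∀ ξ, |f ξ| ≤ 2 * |B| := fun ξ => by
    calc |G ξ - c| ≤ |G ξ| + |c| := abs_sub _ _
      _ ≤ 2 * |B| := by linarith [hB' ξ]
  have hB0 : 0 ≤ 2 * |B| := by positivity
  have hGi : Integrable G Q := integrable_of_abs_le_const (μ := Q) hGm.stronglyMeasurable hGB
  have h0 : ∫ ξ, f ξ ∂Q = 0 := by
    simp only [hf]
    rw [integral_sub hGi (integrable_const c), integral_const, smul_eq_mul, probReal_univ, one_mul,
      sub_self]
  have hP := integral_mul_heatBath_le hloc hinv hC0 hC hα0 hrow hB0 hfm hfB h0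
  have hD := integral_mul_sub_heatBath (q := q) hinv hfm hfB
  have hfG : ∀ (i : ι) (ξ : (j : ι) → E j) (y : E i),
      f ξ - f (update ξ i y) = G ξ - G (update ξ i y) := fun i ξ y => by
    simp only [hf]; ring
  simp_rw [hfG] at hD
  have hi1 : Integrable (fun ξ => f ξ ^ 2) Q :=
    integrable_of_abs_le_const (μ := Q) (hfm.pow_const 2).stronglyMeasurable (R := (2 * |B|) ^ 2) fun ξ => by
      rw [abs_pow]; exact pow_le_pow_left₀ (abs_nonneg _) (hfB ξ) 2
  have hi2m : Measurable (fun ξ => f ξ * heatBath q f ξ) := hfm.mul (measurable_heatBath hfm)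
  have hi2 : Integrable (fun ξ => f ξ * heatBath q f ξ) Q :=
    integrable_of_abs_le_const (μ := Q) hi2m.stronglyMeasurable (R := (2 * |B|) * (2 * |B|)) fun ξ => by
      rw [abs_mul]
      exact mul_le_mul (hfB ξ) (abs_heatBath_le hfB ξ) (abs_nonneg _) hB0
  have hsplit : ∫ ξ, f ξ * (f ξ - heatBath q f ξ) ∂Q
      = ∫ ξ, f ξ ^ 2 ∂Q - ∫ ξ, f ξ * heatBath q f ξ ∂Q := by
    rw [← integral_sub hi1 hi2]
    refine integral_congr_ae (Filter.Eventually.of_forall fun ξ => ?_)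
    ring
  have key : (1 - α) / Fintype.card ι * ∫ ξ, f ξ ^ 2 ∂Q
      ≤ (Fintype.card ι : ℝ)⁻¹ *
          ∑ i, ((1 / 2 : ℝ) * ∫ ξ, (∫ y, (G ξ - G (update ξ i y)) ^ 2 ∂(q i ξ)) ∂Q) := by
    rw [← hD, hsplit]
    have h1 : (1 - α) / Fintype.card ι * ∫ ξ, f ξ ^ 2 ∂Q
        = ∫ ξ, f ξ ^ 2 ∂Q - (1 - (1 - α) / Fintype.card ι) * ∫ ξ, f ξ ^ 2 ∂Q := by ring
    rw [h1]
    linarith [hP]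
  have hS0 : 0 ≤ ∑ i, ((1 / 2 : ℝ) * ∫ ξ, (∫ y, (G ξ - G (update ξ i y)) ^ 2 ∂(q i ξ)) ∂Q) :=
    Finset.sum_nonneg fun i _ => mul_nonneg (by norm_num)
      (integral_nonneg fun ξ => integral_nonneg fun y => sq_nonneg _)
  calc ∫ ξ, (G ξ - c) ^ 2 ∂Q = ∫ ξ, f ξ ^ 2 ∂Q := rfl
    _ = (Fintype.card ι / (1 - α)) * ((1 - α) / Fintype.card ι * ∫ ξ, f ξ ^ 2 ∂Q) := by
        field_simp
    _ ≤ (Fintype.card ι / (1 - α)) * ((Fintype.card ι : ℝ)⁻¹ *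
          ∑ i, ((1 / 2 : ℝ) * ∫ ξ, (∫ y, (G ξ - G (update ξ i y)) ^ 2 ∂(q i ξ)) ∂Q)) :=
        mul_le_mul_of_nonneg_left key (by positivity)
    _ = (1 / (1 - α)) *
          ((1 / 2 : ℝ) * ∑ i, ∫ ξ, (∫ y, (G ξ - G (update ξ i y)) ^ 2 ∂(q i ξ)) ∂Q) := by
        rw [← Finset.mul_sum]
        field_simp

end Main


/-! ## §6 Composition with the NE1′ tower bound (`T4CouplingIncoherence` §9(b))

After this section the tensorisation-side input of the pathwise-coupling variance bound is no
longer an abstract Efron–Stein constant `C_T` but the Dobrushin data of the innovation laws: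
locality + resampling invariance of the single-innovation conditional kernels `q b h i` and a
row-sum bound `∑_{j ≠ i} C b h i j ≤ α₀ < 1`, UNIFORM in the level `b` and the history `h`;
the constant becomes `C_T = 1 / (1 − α₀)`.  (Where such an `α₀` comes from for the dressed
innovation laws of the (2.18)-type actions is the LOCATED analysis input of the record — a
cluster / decoupling expansion output — and is not asserted here.) -/

section Composition

open Preorder MeasureTheory.Filtration
open Literature.MathematicalPhysics.QuantumFieldTheory.Balaban1983to89.T4CouplingChain
open Literature.MathematicalPhysics.QuantumFieldTheory.Balaban1983to89.T4CouplingIncoherence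

variable {X : ℕ → Type*} [∀ n, MeasurableSpace (X n)]
variable {κ : (b : ℕ) → Kernel (Π i : Iic b, X i) (X (b + 1))} [∀ b, IsMarkovKernel (κ b)]

open scoped Classical in
/-- `[folklore]` **MI-ES END-TO-END, DOBRUSHIN FORM (realised chain).**
`T4CouplingIncoherence.integral_sq_sub_towerMean_le_of_graded_geometric_efronSteinWith` with its
hypothesis `hES` DISCHARGED by `efronSteinWith_of_dobrushin`: step laws `κ b h = (Q b h).map (T b h)`,
single-innovation kernels `q b h i` local + resampling-invariant for `Q b h` with Dobrushin
row sums `≤ α₀ < 1` uniformly in `(b, h)`, graded sensitivities on felt sets with geometric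
counts, resampling second moments `≤ S b i ≤ σ²`, product-dominated irregularity events ⇒
`∫ (φ − towerMean)² dμ ≤ (1 − α₀)⁻¹ · ½C²σ² · ν(X 0) · e^{(κ₁²−1)E} · P/(1−r)`. -/
theorem integral_sq_sub_towerMean_le_of_graded_geometric_dobrushin (ν : Measure (X 0))
    [IsFiniteMeasure ν] (n : ℕ) {φ : (Π k, X k) → ℝ} (hφn : StronglyMeasurable[piLE (X := X) n] φ)
    {R : ℝ} (hφR : ∀ x, |φ x| ≤ R)
    {ι : ℕ → Type u} [∀ b, Fintype (ι b)] [∀ b, DecidableEq (ι b)] {E : (b : ℕ) → ι b → Type v}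
    [∀ b i, MeasurableSpace (E b i)]
    {T : (b : ℕ) → (Π i : Iic b, X i) → ((i : ι b) → E b i) → X (b + 1)}
    (hT : ∀ b h, Measurable (T b h))
    (Q : (b : ℕ) → (Π i : Iic b, X i) → Measure ((i : ι b) → E b i))
    [∀ b h, IsProbabilityMeasure (Q b h)]
    (hrep : ∀ b < n, ∀ h, κ b h = (Q b h).map (T b h))
    (q : (b : ℕ) → (Π i : Iic b, X i) → (i : ι b) → Kernel ((j : ι b) → E b j) (E b i))
    [∀ b h i, IsMarkovKernel (q b h i)]
    (hloc : ∀ b h (i : ι b) (ξ : (j : ι b) → E b j) (y : E b i),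
      q b h i (update ξ i y) = q b h i ξ)
    (hinv : ∀ b h (i : ι b) (F : ((j : ι b) → E b j) → ℝ) (B : ℝ), Measurable F →
      (∀ ξ, |F ξ| ≤ B) → ∫ ξ, (∫ y, F (update ξ i y) ∂(q b h i ξ)) ∂Q b h = ∫ ξ, F ξ ∂Q b h)
    (Cdep : (b : ℕ) → (Π i : Iic b, X i) → ι b → ι b → ℝ) (hC0 : ∀ b h i j, 0 ≤ Cdep b h i j)
    (hC : ∀ b h (i j : ι b), j ≠ i → ∀ (ξ : (k : ι b) → E b k) (y y' : E b j) (g : E b i → ℝ)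
      (B D : ℝ), Measurable g → (∀ z, |g z| ≤ B) → (∀ z z', |g z - g z'| ≤ D) →
      |∫ z, g z ∂(q b h i (update ξ j y)) - ∫ z, g z ∂(q b h i (update ξ j y'))|
        ≤ Cdep b h i j * D)
    {α₀ : ℝ} (hα₀ : α₀ < 1) (hrow : ∀ b h (i : ι b), ∑ j ∈ univ.erase i, Cdep b h i j ≤ α₀)
    {c : (b : ℕ) → (Π i : Iic b, X i) → ι b → ℝ} {d : (b : ℕ) → (i : ι b) → E b i → E b i → ℝ}
    (hdi : ∀ b h i ξ, Integrable (fun y => d b i (ξ i) y ^ 2) (q b h i ξ)) {S : (b : ℕ) → ι b → ℝ}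
    (hS : ∀ b h i ξ, ∫ y, d b i (ξ i) y ^ 2 ∂(q b h i ξ) ≤ S b i)
    (hc : ∀ b < n, ∀ h i ξ y, |fiberMean κ (b + 1) φ (succGlue b (h, T b h ξ)) -
        fiberMean κ (b + 1) φ (succGlue b (h, T b h (Function.update ξ i y)))|
          ≤ c b h i * d b i (ξ i) y)
    (hWm : ∀ b, StronglyMeasurable (fun h => ∑ i, c b h i ^ 2 * S b i)) {CW : ℝ}
    (hWb : ∀ b h, |∑ i, c b h i ^ 2 * S b i| ≤ CW)
    (Mf : (b : ℕ) → Finset (ι b)) {C σsq κ₁ Etot : ℝ} (hκ₁ : 1 ≤ κ₁) {Θ : ℕ → ℝ}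
    (hS0 : ∀ b i, 0 ≤ S b i) (hSσ : ∀ b i, S b i ≤ σsq)
    {J : ℕ → Type*} (Jset : (b : ℕ) → ι b → Finset (J b))
    {A : (b : ℕ) → ι b → J b → Set (Π i : Iic b, X i)}
    (hA : ∀ b < n, ∀ i ∈ Mf b, ∀ j ∈ Jset b i, MeasurableSet (A b i j))
    (hc0 : ∀ b < n, ∀ h, ∀ i ∉ Mf b, c b h i = 0)
    (hcg : ∀ b < n, ∀ h, ∀ i ∈ Mf b,
      |c b h i| ≤ C * Θ b * κ₁ ^ ((Jset b i).filter fun j => h ∈ A b i j).card)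
    {ε : (b : ℕ) → ι b → J b → ℝ} (hε : ∀ b < n, ∀ i ∈ Mf b, ∀ j ∈ Jset b i, 0 ≤ ε b i j)
    (hE : ∀ b < n, ∀ i ∈ Mf b, ∑ j ∈ Jset b i, ε b i j ≤ Etot)
    (hdomA : ∀ b < n, ∀ i ∈ Mf b, ∀ S' ⊆ Jset b i,
      (Kernel.trajMeasure ν κ).real (⋂ j ∈ S', {x | frestrictLe b x ∈ A b i j}) ≤
        (Kernel.trajMeasure ν κ).real Set.univ * ∏ j ∈ S', ε b i j)
    (hσ : 0 ≤ σsq) {P r : ℝ} (hP : 0 ≤ P) (hr0 : 0 ≤ r) (hr1 : r < 1)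
    (hgeo : ∀ b, ((Mf b).card : ℝ) * Θ b ^ 2 ≤ P * r ^ b) :
    ∫ x, (φ x - towerMean κ φ (x 0)) ^ 2 ∂(Kernel.trajMeasure ν κ) ≤
      (1 / (1 - α₀)) * ((1 / 2 : ℝ) * (C ^ 2 * σsq) *
        (ν.real Set.univ * Real.exp ((κ₁ ^ 2 - 1) * Etot)) * (P / (1 - r))) := by
  have hCT : (0 : ℝ) ≤ 1 / (1 - α₀) := div_nonneg zero_le_one (by linarith)
  exact integral_sq_sub_towerMean_le_of_graded_geometric_efronSteinWith (κ := κ) ν n hφn hφR hT Q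
    hrep q hCT
    (fun b _ h => efronSteinWith_of_dobrushin (Q b h) (q b h) (hloc b h) (hinv b h) (Cdep b h)
      (hC0 b h) (hC b h) hα₀ (hrow b h))
    hdi hS hc hWm hWb Mf hκ₁ hS0 hSσ Jset hA hc0 hcg hε hE hdomA hσ hP hr0 hr1 hgeo

open scoped Classical in
/-- `[folklore]` **MI-ES END-TO-END, DOBRUSHIN FORM — arbitrary path law, any kernel version.**
`T4CouplingIncoherence.integral_sq_sub_towerMean_le_of_graded_geometric_efronSteinWith_pathLaw`
with `hES` discharged by `efronSteinWith_of_dobrushin` (`C_T = 1 / (1 − α₀)`). -/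
theorem integral_sq_sub_towerMean_le_of_graded_geometric_dobrushin_pathLaw
    (μ : Measure (Π n, X n)) [IsFiniteMeasure μ]
    (κ' : (b : ℕ) → Kernel (Π i : Iic b, X i) (X (b + 1))) [∀ b, IsMarkovKernel (κ' b)]
    (hκ' : ∀ b, μ.map (frestrictLe b) ⊗ₘ κ' b = μ.map (fun x => (frestrictLe b x, x (b + 1))))
    (n : ℕ) {φ : (Π k, X k) → ℝ} (hφn : StronglyMeasurable[piLE (X := X) n] φ) {R : ℝ}
    (hφR : ∀ x, |φ x| ≤ R)
    {ι : ℕ → Type u} [∀ b, Fintype (ι b)] [∀ b, DecidableEq (ι b)] {E : (b : ℕ) → ι b → Type v}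
    [∀ b i, MeasurableSpace (E b i)]
    {T : (b : ℕ) → (Π i : Iic b, X i) → ((i : ι b) → E b i) → X (b + 1)}
    (hT : ∀ b h, Measurable (T b h))
    (Q : (b : ℕ) → (Π i : Iic b, X i) → Measure ((i : ι b) → E b i))
    [∀ b h, IsProbabilityMeasure (Q b h)]
    (hrep : ∀ b < n, ∀ h, κ' b h = (Q b h).map (T b h))
    (q : (b : ℕ) → (Π i : Iic b, X i) → (i : ι b) → Kernel ((j : ι b) → E b j) (E b i))
    [∀ b h i, IsMarkovKernel (q b h i)]
    (hloc : ∀ b h (i : ι b) (ξ : (j : ι b) → E b j) (y : E b i),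
      q b h i (update ξ i y) = q b h i ξ)
    (hinv : ∀ b h (i : ι b) (F : ((j : ι b) → E b j) → ℝ) (B : ℝ), Measurable F →
      (∀ ξ, |F ξ| ≤ B) → ∫ ξ, (∫ y, F (update ξ i y) ∂(q b h i ξ)) ∂Q b h = ∫ ξ, F ξ ∂Q b h)
    (Cdep : (b : ℕ) → (Π i : Iic b, X i) → ι b → ι b → ℝ) (hC0 : ∀ b h i j, 0 ≤ Cdep b h i j)
    (hC : ∀ b h (i j : ι b), j ≠ i → ∀ (ξ : (k : ι b) → E b k) (y y' : E b j) (g : E b i → ℝ)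
      (B D : ℝ), Measurable g → (∀ z, |g z| ≤ B) → (∀ z z', |g z - g z'| ≤ D) →
      |∫ z, g z ∂(q b h i (update ξ j y)) - ∫ z, g z ∂(q b h i (update ξ j y'))|
        ≤ Cdep b h i j * D)
    {α₀ : ℝ} (hα₀ : α₀ < 1) (hrow : ∀ b h (i : ι b), ∑ j ∈ univ.erase i, Cdep b h i j ≤ α₀)
    {c : (b : ℕ) → (Π i : Iic b, X i) → ι b → ℝ} {d : (b : ℕ) → (i : ι b) → E b i → E b i → ℝ}
    (hdi : ∀ b h i ξ, Integrable (fun y => d b i (ξ i) y ^ 2) (q b h i ξ)) {S : (b : ℕ) → ι b → ℝ}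
    (hS : ∀ b h i ξ, ∫ y, d b i (ξ i) y ^ 2 ∂(q b h i ξ) ≤ S b i)
    (hc : ∀ b < n, ∀ h i ξ y, |fiberMean κ' (b + 1) φ (succGlue b (h, T b h ξ)) -
        fiberMean κ' (b + 1) φ (succGlue b (h, T b h (Function.update ξ i y)))|
          ≤ c b h i * d b i (ξ i) y)
    (hWm : ∀ b, StronglyMeasurable (fun h => ∑ i, c b h i ^ 2 * S b i)) {CW : ℝ}
    (hWb : ∀ b h, |∑ i, c b h i ^ 2 * S b i| ≤ CW)
    (Mf : (b : ℕ) → Finset (ι b)) {C σsq κ₁ Etot : ℝ} (hκ₁ : 1 ≤ κ₁) {Θ : ℕ → ℝ}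
    (hS0 : ∀ b i, 0 ≤ S b i) (hSσ : ∀ b i, S b i ≤ σsq)
    {J : ℕ → Type*} (Jset : (b : ℕ) → ι b → Finset (J b))
    {A : (b : ℕ) → ι b → J b → Set (Π i : Iic b, X i)}
    (hA : ∀ b < n, ∀ i ∈ Mf b, ∀ j ∈ Jset b i, MeasurableSet (A b i j))
    (hc0 : ∀ b < n, ∀ h, ∀ i ∉ Mf b, c b h i = 0)
    (hcg : ∀ b < n, ∀ h, ∀ i ∈ Mf b,
      |c b h i| ≤ C * Θ b * κ₁ ^ ((Jset b i).filter fun j => h ∈ A b i j).card)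
    {ε : (b : ℕ) → ι b → J b → ℝ} (hε : ∀ b < n, ∀ i ∈ Mf b, ∀ j ∈ Jset b i, 0 ≤ ε b i j)
    (hE : ∀ b < n, ∀ i ∈ Mf b, ∑ j ∈ Jset b i, ε b i j ≤ Etot)
    (hdomA : ∀ b < n, ∀ i ∈ Mf b, ∀ S' ⊆ Jset b i,
      μ.real (⋂ j ∈ S', {x | frestrictLe b x ∈ A b i j}) ≤ μ.real Set.univ * ∏ j ∈ S', ε b i j)
    (hσ : 0 ≤ σsq) {P r : ℝ} (hP : 0 ≤ P) (hr0 : 0 ≤ r) (hr1 : r < 1)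
    (hgeo : ∀ b, ((Mf b).card : ℝ) * Θ b ^ 2 ≤ P * r ^ b) :
    ∫ x, (φ x - towerMean κ' φ (x 0)) ^ 2 ∂μ ≤
      (1 / (1 - α₀)) * ((1 / 2 : ℝ) * (C ^ 2 * σsq) *
        (μ.real Set.univ * Real.exp ((κ₁ ^ 2 - 1) * Etot)) * (P / (1 - r))) := by
  have hCT : (0 : ℝ) ≤ 1 / (1 - α₀) := div_nonneg zero_le_one (by linarith)
  exact integral_sq_sub_towerMean_le_of_graded_geometric_efronSteinWith_pathLaw μ κ' hκ' n hφn hφR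
    hT Q hrep q hCT
    (fun b _ h => efronSteinWith_of_dobrushin (Q b h) (q b h) (hloc b h) (hinv b h) (Cdep b h)
      (hC0 b h) (hC b h) hα₀ (hrow b h))
    hdi hS hc hWm hWb Mf hκ₁ hS0 hSσ Jset hA hc0 hcg hε hE hdomA hσ hP hr0 hr1 hgeo

end Composition

/-! ## §7 One-site Gibbs kernels of a bounded energy: the hypotheses of §5 from the energy

For a product reference law `⊗ᵢ πᵢ` of probability measures and a bounded measurable energy
`A` on `Π i, E i`, the one-site Gibbs kernels `qᵢ(ξ)(dy) = exp (−A (update ξ i y)) πᵢ(dy) / Zᵢ(ξ)`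
are Markov (`isMarkovKernel_gibbsKernel`), local (`gibbsKernel_update`) and resampling-invariant
for the Gibbs law `Q(dξ) = exp (−A ξ) ⊗ᵢπᵢ(dξ) / Z` (`resamplingInvariant_gibbs` — the DLR
identities on a finite product, proved from the exchange identity `integral_integral_update_swap`
for `⊗ᵢ πᵢ`), and a bound `δ i j` on the MIXED SECOND DIFFERENCES of `A` in two coordinates
`i ≠ j` (`(A ξ^{j←y',i←z} − A ξ^{j←y,i←z}) − (A ξ^{j←y',i←z'} − A ξ^{j←y,i←z'}) ≤ δ i j`) gives the
two-sided minorisation `exp (−δ i j) • qᵢ(ξ^{j←y}) ≤ qᵢ(ξ^{j←y'})` (`gibbsKernel_minorised`), hence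
(§3) the Dobrushin bound `C i j = 1 − exp (−δ i j) ≤ δ i j` and (§5) the tensorised Efron–Stein
inequality for `Q` with `C_T = 1/(1−α)` as soon as `∑_{j≠i} (1 − exp (−δ i j)) ≤ α < 1`
(`efronSteinWith_of_gibbs`; `efronSteinWith_of_gibbs_linear` with `∑_{j≠i} δ i j ≤ α`).
So in this organisation the weak-dependence input is a SUP-NORM statement about the energy alone:
small mixed second differences between distinct sites.  Nothing here refers to the manuscripts
under audit; which energy `A` (the effective action of one renormalisation step given the block
history, on its small-field region) satisfies such a bound uniformly is the located, unproved
analysis input of the record, not a claim of this file. -/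

section Gibbs

open Literature.Probability.Moments.EfronStein

variable (π : (i : ι) → Measure (E i)) [∀ i, IsProbabilityMeasure (π i)]
  (A : ((j : ι) → E j) → ℝ)

/-- `[folklore]` The one-site partition function `Zᵢ(ξ) = ∫ exp (−A (update ξ i z)) dπᵢ(z)`. -/
def siteZ (i : ι) (ξ : (j : ι) → E j) : ℝ := ∫ z, Real.exp (-A (update ξ i z)) ∂π i

/-- `[folklore]` The one-site Gibbs density `exp (−A (update ξ i y)) / Zᵢ(ξ)` w.r.t. `πᵢ`. -/
def gibbsDensity (i : ι) (ξ : (j : ι) → E j) (y : E i) : ℝ :=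
  Real.exp (-A (update ξ i y)) / siteZ π A i ξ

/-- `[folklore]` The one-site Gibbs kernel `qᵢ(ξ)(dy) = gibbsDensity i ξ y · πᵢ(dy)`. -/
def gibbsKernel (i : ι) : Kernel ((j : ι) → E j) (E i) :=
  Kernel.withDensity (Kernel.const ((j : ι) → E j) (π i))
    (fun ξ y => ENNReal.ofReal (gibbsDensity π A i ξ y))

/-- `[folklore]` The total partition function `Z = ∫ exp (−A) d(⊗ᵢ πᵢ)`. -/
def totalZ : ℝ := ∫ ξ, Real.exp (-A ξ) ∂Measure.pi π

/-- `[folklore]` The Gibbs weight `exp (−A ξ) / Z` w.r.t. `⊗ᵢ πᵢ`. -/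
def gibbsWeight (ξ : (j : ι) → E j) : ℝ := Real.exp (-A ξ) / totalZ π A

/-- `[folklore]` The Gibbs law `Q = gibbsWeight · ⊗ᵢ πᵢ`. -/
def gibbsMeasure : Measure ((j : ι) → E j) :=
  (Measure.pi π).withDensity (fun ξ => ENNReal.ofReal (gibbsWeight π A ξ))

variable {π A}

/-! ### §7.1 Elementary bounds and measurability -/

omit [Fintype ι] [DecidableEq ι] [∀ i, MeasurableSpace (E i)] in
/-- `[folklore]` `exp (−a) ≤ exp (−A ξ) ≤ exp a` when `|A| ≤ a`. -/
theorem exp_neg_energy_bounds {a : ℝ} (hAb : ∀ ξ, |A ξ| ≤ a) (ξ : (j : ι) → E j) :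
    Real.exp (-a) ≤ Real.exp (-A ξ) ∧ Real.exp (-A ξ) ≤ Real.exp a := by
  have h := abs_le.1 (hAb ξ)
  exact ⟨Real.exp_le_exp.2 (by linarith), Real.exp_le_exp.2 (by linarith)⟩

omit [Fintype ι] in
/-- `[folklore]` Joint measurability of `(ξ, y) ↦ exp (−A (update ξ i y))`. -/
theorem measurable_exp_neg_energy_update (hAm : Measurable A) (i : ι) :
    Measurable (fun p : ((j : ι) → E j) × E i => Real.exp (-A (update p.1 i p.2))) :=
  Real.measurable_exp.comp (hAm.comp measurable_update').neg

omit [Fintype ι] in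
/-- `[folklore]` `exp (−a) ≤ Zᵢ(ξ) ≤ exp a`. -/
theorem siteZ_bounds (hAm : Measurable A) {a : ℝ} (hAb : ∀ ξ, |A ξ| ≤ a) (i : ι)
    (ξ : (j : ι) → E j) : Real.exp (-a) ≤ siteZ π A i ξ ∧ siteZ π A i ξ ≤ Real.exp a := by
  have hint : Integrable (fun z => Real.exp (-A (update ξ i z))) (π i) :=
    integrable_of_abs_le_const (μ := π i)
      (Real.measurable_exp.comp (hAm.comp (measurable_update ξ)).neg).stronglyMeasurable
      (R := Real.exp a) fun z => by
        rw [abs_of_pos (Real.exp_pos _)]; exact (exp_neg_energy_bounds hAb _).2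
  constructor
  · have h := integral_mono (integrable_const (Real.exp (-a))) hint
      fun z => (exp_neg_energy_bounds hAb (update ξ i z)).1
    simpa [siteZ, probReal_univ] using h
  · have h := integral_mono hint (integrable_const (Real.exp a))
      fun z => (exp_neg_energy_bounds hAb (update ξ i z)).2
    simpa [siteZ, probReal_univ] using h

omit [Fintype ι] in
/-- `[folklore]` `0 < Zᵢ(ξ)`. -/
theorem siteZ_pos (hAm : Measurable A) {a : ℝ} (hAb : ∀ ξ, |A ξ| ≤ a) (i : ι)
    (ξ : (j : ι) → E j) : 0 < siteZ π A i ξ :=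
  (Real.exp_pos _).trans_le (siteZ_bounds hAm hAb i ξ).1

omit [Fintype ι] [∀ i, IsProbabilityMeasure (π i)] in
/-- `[folklore]` `Zᵢ` does not read the `i`-th coordinate. -/
theorem siteZ_update (i : ι) (ξ : (j : ι) → E j) (y : E i) :
    siteZ π A i (update ξ i y) = siteZ π A i ξ := by
  simp [siteZ, update_idem]

omit [Fintype ι] in
/-- `[folklore]` Measurability of `Zᵢ`. -/
theorem measurable_siteZ (hAm : Measurable A) (i : ι) : Measurable (siteZ π A i) :=
  ((measurable_exp_neg_energy_update hAm i).stronglyMeasurable.integral_prod_right'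
    (ν := π i)).measurable

omit [Fintype ι] in
/-- `[folklore]` Joint measurability of the one-site Gibbs density. -/
theorem measurable_gibbsDensity (hAm : Measurable A) (i : ι) :
    Measurable (Function.uncurry (gibbsDensity π A i)) :=
  (measurable_exp_neg_energy_update hAm i).div ((measurable_siteZ hAm i).comp measurable_fst)

omit [Fintype ι] in
/-- `[folklore]` Measurability of the one-site Gibbs density in the resampled variable. -/
theorem measurable_gibbsDensity_right (hAm : Measurable A) (i : ι) (ξ : (j : ι) → E j) :
    Measurable (gibbsDensity π A i ξ) :=
  (measurable_gibbsDensity hAm i).comp measurable_prodMk_left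

omit [Fintype ι] in
/-- `[folklore]` `0 ≤ gibbsDensity ≤ exp (2a)`. -/
theorem gibbsDensity_bounds (hAm : Measurable A) {a : ℝ} (hAb : ∀ ξ, |A ξ| ≤ a) (i : ι)
    (ξ : (j : ι) → E j) (y : E i) :
    0 ≤ gibbsDensity π A i ξ y ∧ gibbsDensity π A i ξ y ≤ Real.exp (2 * a) := by
  have hZ := siteZ_bounds (π := π) hAm hAb i ξ
  have hZ0 := siteZ_pos (π := π) hAm hAb i ξ
  refine ⟨div_nonneg (Real.exp_pos _).le hZ0.le, ?_⟩
  rw [gibbsDensity, div_le_iff₀ hZ0]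
  calc Real.exp (-A (update ξ i y)) ≤ Real.exp a := (exp_neg_energy_bounds hAb _).2
    _ = Real.exp (2 * a) * Real.exp (-a) := by rw [← Real.exp_add]; ring_nf
    _ ≤ Real.exp (2 * a) * siteZ π A i ξ :=
        mul_le_mul_of_nonneg_left hZ.1 (Real.exp_pos _).le

omit [Fintype ι] in
/-- `[folklore]` The one-site Gibbs density integrates to `1`. -/
theorem integral_gibbsDensity (hAm : Measurable A) {a : ℝ} (hAb : ∀ ξ, |A ξ| ≤ a) (i : ι)
    (ξ : (j : ι) → E j) : ∫ y, gibbsDensity π A i ξ y ∂π i = 1 := by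
  simp only [gibbsDensity, div_eq_mul_inv]
  rw [integral_mul_const]
  exact mul_inv_cancel₀ (siteZ_pos hAm hAb i ξ).ne'

omit [Fintype ι] [∀ i, IsProbabilityMeasure (π i)] in
/-- `[folklore]` The one-site Gibbs density does not read the `i`-th coordinate of `ξ`. -/
theorem gibbsDensity_update (i : ι) (ξ : (j : ι) → E j) (y z : E i) :
    gibbsDensity π A i (update ξ i y) z = gibbsDensity π A i ξ z := by
  simp [gibbsDensity, siteZ_update, update_idem]

/-! ### §7.2 The one-site Gibbs kernel: Markov, local, integration formula -/

omit [Fintype ι] in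
/-- `[folklore]` Joint measurability of the `ℝ≥0∞`-valued density of the one-site Gibbs kernel. -/
theorem measurable_gibbsKernelDensity (hAm : Measurable A) (i : ι) :
    Measurable (Function.uncurry fun (ξ : (j : ι) → E j) (y : E i) =>
      ENNReal.ofReal (gibbsDensity π A i ξ y)) :=
  (measurable_gibbsDensity hAm i).ennreal_ofReal

omit [Fintype ι] in
/-- `[folklore]` The one-site Gibbs kernel is `πᵢ` with density `gibbsDensity i ξ`. -/
theorem gibbsKernel_apply (hAm : Measurable A) (i : ι) (ξ : (j : ι) → E j) :
    gibbsKernel π A i ξ = (π i).withDensity (fun y => ENNReal.ofReal (gibbsDensity π A i ξ y)) := by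
  rw [gibbsKernel, Kernel.withDensity_apply _ (measurable_gibbsKernelDensity hAm i),
    Kernel.const_apply]

omit [Fintype ι] in
/-- `[folklore]` Integration against the one-site Gibbs kernel. -/
theorem integral_gibbsKernel (hAm : Measurable A) {a : ℝ} (hAb : ∀ ξ, |A ξ| ≤ a) (i : ι)
    (ξ : (j : ι) → E j) (g : E i → ℝ) :
    ∫ y, g y ∂(gibbsKernel π A i ξ) = ∫ y, gibbsDensity π A i ξ y * g y ∂π i := by
  rw [gibbsKernel_apply hAm, integral_withDensity_eq_integral_toReal_smul
    (measurable_gibbsDensity_right hAm i ξ).ennreal_ofReal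
    (Filter.Eventually.of_forall fun _ => ENNReal.ofReal_lt_top)]
  refine integral_congr_ae (Filter.Eventually.of_forall fun y => ?_)
  simp only [smul_eq_mul]
  rw [ENNReal.toReal_ofReal (gibbsDensity_bounds hAm hAb i ξ y).1]

omit [Fintype ι] in
/-- `[folklore]` The one-site Gibbs kernel is a MARKOV kernel. -/
theorem isMarkovKernel_gibbsKernel (hAm : Measurable A) {a : ℝ} (hAb : ∀ ξ, |A ξ| ≤ a) (i : ι) :
    IsMarkovKernel (gibbsKernel π A i) := by
  refine ⟨fun ξ => ⟨?_⟩⟩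
  rw [gibbsKernel_apply hAm, withDensity_apply _ MeasurableSet.univ, Measure.restrict_univ]
  have hint : Integrable (gibbsDensity π A i ξ) (π i) :=
    integrable_of_abs_le_const (μ := π i) (measurable_gibbsDensity_right hAm i ξ).stronglyMeasurable
      (R := Real.exp (2 * a)) fun y => by
        rw [abs_of_nonneg (gibbsDensity_bounds hAm hAb i ξ y).1]
        exact (gibbsDensity_bounds hAm hAb i ξ y).2
  rw [← ofReal_integral_eq_lintegral_ofReal hint
    (Filter.Eventually.of_forall fun y => (gibbsDensity_bounds hAm hAb i ξ y).1),
    integral_gibbsDensity hAm hAb, ENNReal.ofReal_one]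

omit [Fintype ι] in
/-- `[folklore]` LOCALITY: the one-site Gibbs kernel does not read the coordinate it resamples. -/
theorem gibbsKernel_update (hAm : Measurable A) (i : ι) (ξ : (j : ι) → E j) (y : E i) :
    gibbsKernel π A i (update ξ i y) = gibbsKernel π A i ξ := by
  rw [gibbsKernel_apply hAm, gibbsKernel_apply hAm]
  simp_rw [gibbsDensity_update]

/-! ### §7.3 The Gibbs law and the DLR (resampling-invariance) identity -/

omit [DecidableEq ι] in
/-- `[folklore]` `exp (−a) ≤ Z ≤ exp a`. -/
theorem totalZ_bounds (hAm : Measurable A) {a : ℝ} (hAb : ∀ ξ, |A ξ| ≤ a) :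
    Real.exp (-a) ≤ totalZ π A ∧ totalZ π A ≤ Real.exp a := by
  have hint : Integrable (fun ξ => Real.exp (-A ξ)) (Measure.pi π) :=
    integrable_of_abs_le_const (μ := Measure.pi π)
      (Real.measurable_exp.comp hAm.neg).stronglyMeasurable (R := Real.exp a) fun ξ => by
        rw [abs_of_pos (Real.exp_pos _)]; exact (exp_neg_energy_bounds hAb _).2
  constructor
  · have h := integral_mono (integrable_const (Real.exp (-a))) hint
      fun ξ => (exp_neg_energy_bounds hAb ξ).1
    simpa [totalZ, probReal_univ] using h
  · have h := integral_mono hint (integrable_const (Real.exp a))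
      fun ξ => (exp_neg_energy_bounds hAb ξ).2
    simpa [totalZ, probReal_univ] using h

omit [DecidableEq ι] in
/-- `[folklore]` `0 < Z`. -/
theorem totalZ_pos (hAm : Measurable A) {a : ℝ} (hAb : ∀ ξ, |A ξ| ≤ a) : 0 < totalZ π A :=
  (Real.exp_pos _).trans_le (totalZ_bounds hAm hAb).1

omit [DecidableEq ι] in
/-- `[folklore]` `0 ≤ gibbsWeight ≤ exp (2a)`. -/
theorem gibbsWeight_bounds (hAm : Measurable A) {a : ℝ} (hAb : ∀ ξ, |A ξ| ≤ a)
    (ξ : (j : ι) → E j) :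
    0 ≤ gibbsWeight π A ξ ∧ gibbsWeight π A ξ ≤ Real.exp (2 * a) := by
  have hZ := totalZ_bounds (π := π) hAm hAb
  have hZ0 := totalZ_pos (π := π) hAm hAb
  refine ⟨div_nonneg (Real.exp_pos _).le hZ0.le, ?_⟩
  rw [gibbsWeight, div_le_iff₀ hZ0]
  calc Real.exp (-A ξ) ≤ Real.exp a := (exp_neg_energy_bounds hAb _).2
    _ = Real.exp (2 * a) * Real.exp (-a) := by rw [← Real.exp_add]; ring_nf
    _ ≤ Real.exp (2 * a) * totalZ π A := mul_le_mul_of_nonneg_left hZ.1 (Real.exp_pos _).le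

omit [DecidableEq ι] [∀ i, IsProbabilityMeasure (π i)] in
/-- `[folklore]` Measurability of the Gibbs weight. -/
theorem measurable_gibbsWeight (hAm : Measurable A) : Measurable (gibbsWeight π A) :=
  (Real.measurable_exp.comp hAm.neg).div_const _

omit [DecidableEq ι] in
/-- `[folklore]` Integration against the Gibbs law. -/
theorem integral_gibbsMeasure (hAm : Measurable A) {a : ℝ} (hAb : ∀ ξ, |A ξ| ≤ a)
    (G : ((j : ι) → E j) → ℝ) :
    ∫ ξ, G ξ ∂gibbsMeasure π A = ∫ ξ, gibbsWeight π A ξ * G ξ ∂Measure.pi π := by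
  rw [gibbsMeasure, integral_withDensity_eq_integral_toReal_smul
    (measurable_gibbsWeight hAm).ennreal_ofReal
    (Filter.Eventually.of_forall fun _ => ENNReal.ofReal_lt_top)]
  refine integral_congr_ae (Filter.Eventually.of_forall fun ξ => ?_)
  simp only [smul_eq_mul]
  rw [ENNReal.toReal_ofReal (gibbsWeight_bounds hAm hAb ξ).1]

omit [DecidableEq ι] in
/-- `[folklore]` The Gibbs weight integrates to `1`. -/
theorem integral_gibbsWeight (hAm : Measurable A) {a : ℝ} (hAb : ∀ ξ, |A ξ| ≤ a) :
    ∫ ξ, gibbsWeight π A ξ ∂Measure.pi π = 1 := by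
  simp only [gibbsWeight, div_eq_mul_inv]
  rw [integral_mul_const]
  exact mul_inv_cancel₀ (totalZ_pos hAm hAb).ne'

omit [DecidableEq ι] in
/-- `[folklore]` The Gibbs law is a probability measure. -/
theorem isProbabilityMeasure_gibbsMeasure (hAm : Measurable A) {a : ℝ} (hAb : ∀ ξ, |A ξ| ≤ a) :
    IsProbabilityMeasure (gibbsMeasure π A) := by
  refine ⟨?_⟩
  rw [gibbsMeasure, withDensity_apply _ MeasurableSet.univ, Measure.restrict_univ]
  have hint : Integrable (gibbsWeight π A) (Measure.pi π) :=
    integrable_of_abs_le_const (μ := Measure.pi π) (measurable_gibbsWeight hAm).stronglyMeasurable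
      (R := Real.exp (2 * a)) fun ξ => by
        rw [abs_of_nonneg (gibbsWeight_bounds hAm hAb ξ).1]
        exact (gibbsWeight_bounds hAm hAb ξ).2
  rw [← ofReal_integral_eq_lintegral_ofReal hint
    (Filter.Eventually.of_forall fun ξ => (gibbsWeight_bounds hAm hAb ξ).1),
    integral_gibbsWeight hAm hAb, ENNReal.ofReal_one]

/-- `[folklore]` THE EXCHANGE IDENTITY for a product law: for bounded jointly measurable `Φ`,
`∫∫ Φ ξ y dπᵢ(y) d(⊗π)(ξ) = ∫∫ Φ (update ξ i y) (ξ i) dπᵢ(y) d(⊗π)(ξ)` — under `⊗π ⊗ πᵢ` the pair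
`(ξ, y)` and the pair `(update ξ i y, ξ i)` have the same law.  Proof on the doubled product
`⊗ᵢ (πᵢ ⊗ πᵢ)`, where the exchange is the coordinate flip at `i`
(`EfronStein.measurePreserving_flip`). -/
theorem integral_integral_update_swap (i : ι) {Φ : ((j : ι) → E j) → E i → ℝ}
    (hΦm : Measurable (Function.uncurry Φ)) {B : ℝ} (hΦb : ∀ ξ y, |Φ ξ y| ≤ B) :
    ∫ ξ, (∫ y, Φ ξ y ∂π i) ∂Measure.pi π =
      ∫ ξ, (∫ y, Φ (update ξ i y) (ξ i) ∂π i) ∂Measure.pi π := by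
  classical
  -- the doubled space and the reading map `U ω = (first copies, second copy at i)`
  set D : Measure ((j : ι) → E j × E j) := Measure.pi fun j => (π j).prod (π j) with hD
  let U : ((j : ι) → E j × E j) → ((j : ι) → E j) × E i := fun ω => (fun j => (ω j).1, (ω i).2)
  have hU : MeasurePreserving U D ((Measure.pi π).prod (π i)) :=
    ((MeasurePreserving.id (Measure.pi π)).prod (measurePreserving_eval π i)).comp
      (measurePreserving_unzip π π)
  let fl : Finset ι → ((j : ι) → E j × E j) → (j : ι) → E j × E j :=
    fun S ω j => if j ∈ S then (ω j).swap else ω j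
  have hfl : MeasurePreserving (fl {i}) D D := measurePreserving_flip π (fun _ _ _ => rfl) {i}
  -- the second integrand
  let Ψ : ((j : ι) → E j) → E i → ℝ := fun ξ y => Φ (update ξ i y) (ξ i)
  have hΨm : Measurable (Function.uncurry Ψ) :=
    hΦm.comp (measurable_update'.prodMk ((measurable_pi_apply i).comp measurable_fst))
  have hΦi : Integrable (Function.uncurry Φ) ((Measure.pi π).prod (π i)) :=
    integrable_of_abs_le_const hΦm.stronglyMeasurable fun p => hΦb p.1 p.2
  have hΨi : Integrable (Function.uncurry Ψ) ((Measure.pi π).prod (π i)) :=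
    integrable_of_abs_le_const hΨm.stronglyMeasurable fun p => hΦb _ _
  -- pointwise: reading after the flip is `Ψ` read before the flip
  have hpt : ∀ ω, Function.uncurry Φ (U (fl {i} ω)) = Function.uncurry Ψ (U ω) := by
    intro ω
    simp only [Function.uncurry, U, Ψ, fl, Finset.mem_singleton, if_true, Prod.swap]
    congr 1
    funext j
    by_cases hj : j = i
    · subst hj; simp
    · simp [hj]
  calc ∫ ξ, (∫ y, Φ ξ y ∂π i) ∂Measure.pi π
      = ∫ p, Function.uncurry Φ p ∂(Measure.pi π).prod (π i) := (integral_prod _ hΦi).symm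
    _ = ∫ ω, Function.uncurry Φ (U ω) ∂D :=
        (integral_comp_eq hU hΦi.aestronglyMeasurable).symm
    _ = ∫ ω, Function.uncurry Φ (U (fl {i} ω)) ∂D :=
        (integral_comp_eq hfl (φ := fun ω => Function.uncurry Φ (U ω))
          ((hΦm.comp hU.measurable).aestronglyMeasurable)).symm
    _ = ∫ ω, Function.uncurry Ψ (U ω) ∂D := by simp_rw [hpt]
    _ = ∫ p, Function.uncurry Ψ p ∂(Measure.pi π).prod (π i) :=
        integral_comp_eq hU hΨi.aestronglyMeasurable
    _ = ∫ ξ, (∫ y, Φ (update ξ i y) (ξ i) ∂π i) ∂Measure.pi π := integral_prod _ hΨi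

/-- `[folklore]` RESAMPLING INVARIANCE (the DLR identity on a finite product): the Gibbs law is
invariant under resampling any one coordinate from its one-site Gibbs kernel. -/
theorem resamplingInvariant_gibbs (hAm : Measurable A) {a : ℝ} (hAb : ∀ ξ, |A ξ| ≤ a) :
    ResamplingInvariant (gibbsMeasure π A) (gibbsKernel π A) := by
  intro i F B hFm hFB
  have hd := gibbsDensity_bounds (π := π) hAm hAb i
  have hw := gibbsWeight_bounds (π := π) hAm hAb
  -- unfold both sides to integrals against `⊗π`
  rw [integral_gibbsMeasure hAm hAb, integral_gibbsMeasure hAm hAb]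
  simp_rw [integral_gibbsKernel hAm hAb]
  -- the joint integrand before the exchange
  set Φ : ((j : ι) → E j) → E i → ℝ :=
    fun ξ y => gibbsWeight π A ξ * (gibbsDensity π A i ξ y * F (update ξ i y)) with hΦ
  have hΦm : Measurable (Function.uncurry Φ) :=
    ((measurable_gibbsWeight hAm).comp measurable_fst).mul
      ((measurable_gibbsDensity hAm i).mul (hFm.comp measurable_update'))
  have hΦb : ∀ ξ y, |Φ ξ y| ≤ Real.exp (2 * a) * (Real.exp (2 * a) * |B|) := by
    intro ξ y
    rw [hΦ, abs_mul, abs_mul, abs_of_nonneg (hw ξ).1, abs_of_nonneg (hd ξ y).1]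
    exact mul_le_mul (hw ξ).2 (mul_le_mul (hd ξ y).2 ((hFB _).trans (le_abs_self B))
      (abs_nonneg _) (Real.exp_pos _).le) (mul_nonneg (hd ξ y).1 (abs_nonneg _))
      (Real.exp_pos _).le
  have hL : ∀ ξ, gibbsWeight π A ξ * ∫ y, gibbsDensity π A i ξ y * F (update ξ i y) ∂π i
      = ∫ y, Φ ξ y ∂π i := fun ξ => by
    rw [hΦ, ← integral_const_mul]
  simp_rw [hL]
  rw [integral_integral_update_swap i hΦm hΦb]
  refine integral_congr_ae (Filter.Eventually.of_forall fun ξ => ?_)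
  -- after the exchange: `Φ (update ξ i y) (ξ i) = gibbsWeight (update ξ i y) * (exp(−A ξ)/Zᵢ ξ) * F ξ`
  have hZ0 := siteZ_pos (π := π) hAm hAb i ξ
  have hT0 := totalZ_pos (π := π) hAm hAb
  have hpt : ∀ y, Φ (update ξ i y) (ξ i)
      = Real.exp (-A (update ξ i y)) * (F ξ * Real.exp (-A ξ) / (siteZ π A i ξ * totalZ π A)) := by
    intro y
    simp only [hΦ, gibbsWeight, gibbsDensity, update_idem, update_eq_self, siteZ_update]
    field_simp
  simp_rw [hpt]
  rw [integral_mul_const]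
  change siteZ π A i ξ * (F ξ * Real.exp (-A ξ) / (siteZ π A i ξ * totalZ π A))
    = gibbsWeight π A ξ * F ξ
  rw [gibbsWeight]
  field_simp

/-! ### §7.4 Minorisation from bounded mixed second differences, and the final inequality -/

omit [Fintype ι] in
/-- `[folklore]` MINORISATION FROM MIXED SECOND DIFFERENCES: if changing the `j`-th coordinate
changes the `i`-th one-site energy landscape by a function of oscillation `≤ δ i j`, then
`exp (−δ i j) • qᵢ(ξ^{j←y}) ≤ qᵢ(ξ^{j←y'})`. -/
theorem gibbsKernel_minorised (hAm : Measurable A) {a : ℝ} (hAb : ∀ ξ, |A ξ| ≤ a)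
    {δ : ι → ι → ℝ}
    (hδ : ∀ (i j : ι), j ≠ i → ∀ (ξ : (k : ι) → E k) (y y' : E j) (z z' : E i),
      (A (update (update ξ j y') i z) - A (update (update ξ j y) i z)) -
        (A (update (update ξ j y') i z') - A (update (update ξ j y) i z')) ≤ δ i j) :
    ∀ (i j : ι), j ≠ i → ∀ (ξ : (k : ι) → E k) (y y' : E j),
      ENNReal.ofReal (Real.exp (-δ i j)) • gibbsKernel π A i (update ξ j y) ≤
        gibbsKernel π A i (update ξ j y') := by
  intro i j hji ξ y y'
  rw [gibbsKernel_apply hAm, gibbsKernel_apply hAm,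
    ← withDensity_smul _ (measurable_gibbsDensity_right hAm i _).ennreal_ofReal]
  refine withDensity_mono (Filter.Eventually.of_forall fun z => ?_)
  simp only [Pi.smul_apply, smul_eq_mul]
  rw [← ENNReal.ofReal_mul (Real.exp_pos _).le]
  refine ENNReal.ofReal_le_ofReal ?_
  -- the real inequality `e^{-δ} e^{-A(y,z)}/Z(y) ≤ e^{-A(y',z)}/Z(y')`
  set η := update ξ j y with hη
  set η' := update ξ j y' with hη'
  have hZ := siteZ_pos (π := π) hAm hAb i η
  have hZ' := siteZ_pos (π := π) hAm hAb i η'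
  -- `Z(y') ≤ e^{δ - D(z)} Z(y)` with `D(w) = A(η'^{i←w}) − A(η^{i←w})`
  have hD : ∀ w, -(A (update η' i w) - A (update η i w))
      ≤ δ i j - (A (update η' i z) - A (update η i z)) := fun w => by
    have := hδ i j hji ξ y y' z w; linarith
  have hintη : Integrable (fun w => Real.exp (-A (update η i w))) (π i) :=
    integrable_of_abs_le_const (μ := π i)
      (Real.measurable_exp.comp (hAm.comp (measurable_update η)).neg).stronglyMeasurable
      (R := Real.exp a) fun w => by
        rw [abs_of_pos (Real.exp_pos _)]; exact (exp_neg_energy_bounds hAb _).2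
  have hZle : siteZ π A i η' ≤
      Real.exp (δ i j - (A (update η' i z) - A (update η i z))) * siteZ π A i η := by
    rw [siteZ, siteZ, ← integral_const_mul]
    refine integral_mono ?_ (hintη.const_mul _) fun w => ?_
    · exact integrable_of_abs_le_const (μ := π i)
        (Real.measurable_exp.comp (hAm.comp (measurable_update η')).neg).stronglyMeasurable
        (R := Real.exp a) fun w => by
          rw [abs_of_pos (Real.exp_pos _)]; exact (exp_neg_energy_bounds hAb _).2
    · calc Real.exp (-A (update η' i w))
          = Real.exp (-(A (update η' i w) - A (update η i w))) * Real.exp (-A (update η i w)) := by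
            rw [← Real.exp_add]; ring_nf
        _ ≤ Real.exp (δ i j - (A (update η' i z) - A (update η i z))) *
              Real.exp (-A (update η i w)) :=
            mul_le_mul_of_nonneg_right (Real.exp_le_exp.2 (hD w)) (Real.exp_pos _).le
  rw [gibbsDensity, gibbsDensity, mul_div_assoc', div_le_div_iff₀ hZ hZ']
  calc Real.exp (-δ i j) * Real.exp (-A (update η i z)) * siteZ π A i η'
      ≤ Real.exp (-δ i j) * Real.exp (-A (update η i z)) *
          (Real.exp (δ i j - (A (update η' i z) - A (update η i z))) * siteZ π A i η) :=
        mul_le_mul_of_nonneg_left hZle (mul_nonneg (Real.exp_pos _).le (Real.exp_pos _).le)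
    _ = Real.exp (-A (update η' i z)) * siteZ π A i η := by
        rw [show Real.exp (-δ i j) * Real.exp (-A (update η i z)) *
            (Real.exp (δ i j - (A (update η' i z) - A (update η i z))) * siteZ π A i η)
            = (Real.exp (-δ i j) * Real.exp (-A (update η i z)) *
              Real.exp (δ i j - (A (update η' i z) - A (update η i z)))) * siteZ π A i η by ring,
          ← Real.exp_add, ← Real.exp_add]
        ring_nf

omit [Fintype ι] [∀ i, MeasurableSpace (E i)] in
/-- `[folklore]` A mixed-second-difference bound is non-negative (take `z = z'`). -/
theorem mixedDiff_nonneg {δ : ι → ι → ℝ}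
    (hδ : ∀ (i j : ι), j ≠ i → ∀ (ξ : (k : ι) → E k) (y y' : E j) (z z' : E i),
      (A (update (update ξ j y') i z) - A (update (update ξ j y) i z)) -
        (A (update (update ξ j y') i z') - A (update (update ξ j y) i z')) ≤ δ i j)
    [∀ i, Nonempty (E i)] (i j : ι) (hji : j ≠ i) : 0 ≤ δ i j := by
  classical
  obtain ⟨ξ⟩ := (inferInstance : Nonempty ((k : ι) → E k))
  have := hδ i j hji ξ (ξ j) (ξ j) (ξ i) (ξ i)
  simpa using this

/-- `[folklore]` **THE TENSORISED EFRON–STEIN INEQUALITY FOR A GIBBS LAW WITH SMALL MIXED SECOND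
DIFFERENCES.**  For a bounded measurable energy `A` on a finite product with reference law `⊗πᵢ`
whose mixed second differences between distinct sites are bounded by `δ i j` with
`∑_{j≠i} (1 − exp (−δ i j)) ≤ α < 1`, the Gibbs law `Q` and its one-site Gibbs kernels satisfy
the hypothesis `hES` of `T4CouplingIncoherence` §9 with `C_T = 1/(1−α)`. -/
theorem efronSteinWith_of_gibbs (hAm : Measurable A) {a : ℝ} (hAb : ∀ ξ, |A ξ| ≤ a)
    {δ : ι → ι → ℝ} (hδ0 : ∀ i j, 0 ≤ δ i j)
    (hδ : ∀ (i j : ι), j ≠ i → ∀ (ξ : (k : ι) → E k) (y y' : E j) (z z' : E i),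
      (A (update (update ξ j y') i z) - A (update (update ξ j y) i z)) -
        (A (update (update ξ j y') i z') - A (update (update ξ j y) i z')) ≤ δ i j)
    {α : ℝ} (hα : α < 1) (hrow : ∀ i, ∑ j ∈ univ.erase i, (1 - Real.exp (-δ i j)) ≤ α) :
    ∀ (G : ((i : ι) → E i) → ℝ) (B : ℝ), Measurable G → (∀ ξ, |G ξ| ≤ B) →
      ∫ ξ, (G ξ - ∫ ζ, G ζ ∂gibbsMeasure π A) ^ 2 ∂gibbsMeasure π A ≤
        (1 / (1 - α)) * ((1 / 2 : ℝ) * ∑ i, ∫ ξ, (∫ y, (G ξ - G (update ξ i y)) ^ 2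
          ∂(gibbsKernel π A i ξ)) ∂gibbsMeasure π A) := by
  haveI := isProbabilityMeasure_gibbsMeasure (π := π) hAm hAb
  haveI : ∀ i, IsMarkovKernel (gibbsKernel π A i) :=
    fun i => isMarkovKernel_gibbsKernel (π := π) hAm hAb i
  have hDob : DobrushinBound (gibbsKernel π A) (fun i j => 1 - Real.exp (-δ i j)) :=
    dobrushinBound_of_minorised (fun i j => (Real.exp_pos _).le)
      (gibbsKernel_minorised hAm hAb hδ)
  exact efronSteinWith_of_dobrushin (gibbsMeasure π A) (gibbsKernel π A)
    (gibbsKernel_update hAm) (resamplingInvariant_gibbs hAm hAb)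
    (fun i j => 1 - Real.exp (-δ i j))
    (fun i j => by have := Real.exp_le_one_iff.2 (neg_nonpos.2 (hδ0 i j)); linarith)
    hDob hα hrow

/-- `[folklore]` Linearised form: `∑_{j≠i} δ i j ≤ α < 1` suffices (`1 − exp (−x) ≤ x`). -/
theorem efronSteinWith_of_gibbs_linear (hAm : Measurable A) {a : ℝ} (hAb : ∀ ξ, |A ξ| ≤ a)
    {δ : ι → ι → ℝ} (hδ0 : ∀ i j, 0 ≤ δ i j)
    (hδ : ∀ (i j : ι), j ≠ i → ∀ (ξ : (k : ι) → E k) (y y' : E j) (z z' : E i),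
      (A (update (update ξ j y') i z) - A (update (update ξ j y) i z)) -
        (A (update (update ξ j y') i z') - A (update (update ξ j y) i z')) ≤ δ i j)
    {α : ℝ} (hα : α < 1) (hrow : ∀ i, ∑ j ∈ univ.erase i, δ i j ≤ α) :
    ∀ (G : ((i : ι) → E i) → ℝ) (B : ℝ), Measurable G → (∀ ξ, |G ξ| ≤ B) →
      ∫ ξ, (G ξ - ∫ ζ, G ζ ∂gibbsMeasure π A) ^ 2 ∂gibbsMeasure π A ≤
        (1 / (1 - α)) * ((1 / 2 : ℝ) * ∑ i, ∫ ξ, (∫ y, (G ξ - G (update ξ i y)) ^ 2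
          ∂(gibbsKernel π A i ξ)) ∂gibbsMeasure π A) :=
  efronSteinWith_of_gibbs hAm hAb hδ0 hδ hα fun i =>
    (Finset.sum_le_sum fun j _ => by
      have := Real.one_sub_le_exp_neg (δ i j); linarith).trans (hrow i)

end Gibbs

end Literature.MathematicalPhysics.QuantumFieldTheory.Balaban1983to89.T4DobrushinTensorisation
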